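import Literature.MathematicalPhysics.QuantumLattice.FermionBlockRGComposition
import HarnessLib

/-!
# The fluctuation integral of the fermionic block-spin transformation: Dimock, *QED on the
# 3-torus II*, §1.3.2 (38)–(41) — `T_{a,Q}(e^{−ψ̄Dψ} f) = e^{−χ̄D₁χ} ∫ f(ψ + Hχ) dμ_F(ψ)` for an ARBITRARY
# density `f`, by the change of variables `ψ → ψ + Hχ`, §1.3.3 (43)–(44) — the generating function
# `Ω(Ψ, η) = Z e^{−(Ψ̄,D₁Ψ) + (η̄,HΨ) + (Ψ̄H̄,η) + (η̄,F⁻¹η)}`, §1.3.3 (45)–(48) ∕ §1.3.4 (50)–(51) — its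
# one-step RG flow `(Z_k, D_k, H_k, S_k) → (Z_{k+1}, D_{k+1}, H_{k+1}, S_{k+1})` (unscaled), its gauge
# covariance (42) and the `k`-fold iterate `Ω_k = T_{k−1}⋯T_0 Ω_0` ((30) with sources), PROVED

statement-level skeleton of published theorems with citation tags; proofs where landed; nothing here is a claim about the Yang–Mills mass gap

**Citation header (reproduction of PUBLISHED work).**
* J. Dimock, *Quantum electrodynamics on the 3-torus. II. The renormalization group flow*,
  arXiv:math-ph/0407063 (2004) [Dimock2004QED3TorusII], **§1.3.2, (38)–(41) with the two-line proof of
  (38)**, p.8 L11–53, **§1.3.3, the generating function (43)–(44)**, p.8 L57–78, **its one-step recursion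
  (45)–(48)**, p.8 L79 – p.9 L30, **§1.3.4 (50)–(51)**, p.9 L35–42, the gauge covariance **(42)**, p.8 L54–56, and
  the `k`-fold formula **(30)**, p.7 L3–30 (*"proved by induction"*, L61), of the arXiv-v1 text
  layer `paper:arxiv-math-ph_0407063` (`p.NN Lnn` = PDF page ∕ text-layer line). Writer seat p11 (literature-prover-lit-balaban-p11-g17-0; §§7–9: -g18-0), YM LIT SWEEP item (c)
  D13; companion of `FermionBlockRGComposition.lean` (App. A LEMMA 5, the case `f = ` Gaussian) and of the
  tree's `WilsonFermionBlockAveraging.lean` (`fermionBlockRG_grassmannExp_quadratic`, the case `f = 1`).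
* T. Bałaban, M. O'Carroll, R. Schor, *Block renormalization group for Euclidean fermions*, Commun.
  Math. Phys. **122** (1989) 233–247 [BalabanOcarrollSchor1989] (held: `paper:doi-10-1007-bf01257414`),
  §II p.237 L15–18 (the translation formula and the Gaussian integral) and Lemma II.2 ∕ (23) (the block
  action `D^{(k)}` and the fluctuation two-point function `Γ = (D + aQ*Q)⁻¹`).

**The printed statements.** Dimock p.8 L11–53: *"Now assume that `e_k|∂A|` is sufficiently small. Then
we claim that an integral like the right side of (30) with `Q_k(A)` can be evaluated as*
`∫ dψ M⁻¹_{k,b_k} exp(−b_k|Ψ_k − Q_k(A)ψ|²) exp(−(ψ̄, (D_{e_k}(A) + m_k)ψ)) f(ψ)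
   = Z_k(A) exp(−(Ψ̄_k, D_k(A)Ψ_k)) ∫ f(ψ + H_k(A)Ψ_k) dμ_{S_k(A)}(ψ)` (38)
*Here* `D#_k(A) = D(A) + m_k + b_k Q_k(−A)ᵀQ_k(A)` (39). *Under the conditions on `e_k|∂A|` this
operator is invertible (about which more later) and we define* `S_k(A) = D#_k(A)⁻¹`,
`H_k(A) = b_k S_k(A)Q_k(−A)ᵀ` *on* `Ψ_k`, `b_k S_k(A)ᵀQ_k(A)ᵀ` *on* `Ψ̄_k`,
`D_k(A) = b_k − b_k² Q_k(A)S_k(A)Q_k(−A)ᵀ` (40). *Also `∫[…]dμ_{S_k(A)}(ψ)` is the fermion Gaussian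
integral with covariance `S_k(A)`. To prove (38) make the transformation `ψ → ψ + H_k(A)Ψ_k` and
similarly for `ψ̄`. This diagonalizes the quadratic form and gives `(Ψ̄_k, D_k(A)Ψ_k) + (ψ̄, D#_k(A)ψ)`,
whence the result with* `Z_k(A) = M⁻¹_{k,b_k} ∫ e^{−(ψ̄, D#_k(A)ψ)}` (41)." (The notation
`|Ψ − Qψ|² = (Ψ̄ − Q(−A)ψ̄, Ψ − Q(A)ψ)` is (6) p.4.)  §1.3.3 p.8 L57–78: *"We specifically consider the
generating function* `Ω_k(A, Ψ_k, η) = ∫ dψ M⁻¹_{k,b_k} exp(−b_k|Ψ_k − Q_k(A)ψ|²) exp(−(ψ̄, (D_{e_k}(A) + m_k)ψ))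
e^{(η̄,ψ)+(ψ̄,η)}` (43) *where `η, η̄` are elements of an auxiliary Grassmann algebra indexed by
`T^{−k}_{N+M−k}`. Using (38) and `∫ exp((η̄, ψ) + (ψ̄, η))dμ_{S_k(A)}(ψ) = exp((η̄, S_k(A)η))` this can be
evaluated as* `Ω_k(A, Ψ_k, η) = Z_k(A) exp(−(Ψ̄_k, D_k(A)Ψ_k) + (η̄, H_k(A)Ψ_k) + (H_k(A)Ψ̄_k, η) + (η̄, S_k(A)η))`
(44). *We can also take it one step at a time. By (35) we have for `A` on `T^{−k−1}_{N+M−k−1}`*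
`Ω_{k+1}(A, Ψ_{k+1}, η) = ∫ M⁻¹_{k+1,b} exp(−(b/L)|Ψ_{k+1,L} − Q_{e_k}(Q̃_kA_L)Ψ_k|²) Ω_k(A_L, Ψ_k, (σ_L⁻¹)ᵀη)` (45).
*Put in the expression for `Ω_k` and evaluate this by introducing*
`Γ_k(A) = (D_k(A) + (b/L) Q_{e_k}(−Q̃_kA)ᵀQ_{e_k}(Q̃_kA))⁻¹`, `H_k(A) = (b/L) Γ_k(A)Q_{e_k}(−Q̃_kA)ᵀ` *on* `Ψ_k`,
`(b/L) Γ_k(A)ᵀQ_{e_k}(Q̃_kA)ᵀ` *on* `Ψ̄_k` (46) *and making the transformation `Ψ_k → Ψ_k + H_k(A_L)Ψ_{k+1,L}`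
and similarly for `Ψ̄_k`. We get an alternative expression for `Ω_{k+1}` and by comparing we find*
`S_{k+1}(A) = σ_L⁻¹(S_k(A_L) + H_k(A_L)Γ_k(A_L)H_k(A_L)ᵀ)(σ_L⁻¹)ᵀ`, `H_{k+1}(A) = σ_L⁻¹H_k(A_L)H_k(A_L)σ_L`,
`D_{k+1}(A) = σ_Lᵀ((b/L) − (b²/L²) Q_{e_k}(Q̃_kA_L)Γ_k(A_L)Q_{e_k}(−Q̃_kA_L)ᵀ)σ_L` (47). *(The convention is
that `S_0(A) = 0`, `H_0(A) = I`, and `D_0(A) = D_{e_0}(A) + m_0`.) We also find that*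
`Z_{k+1}(A) = Z_k(A_L) M⁻¹_{k+1,b} ∫ e^{−(Ψ̄_k, Γ_k(A_L)⁻¹Ψ_k)} dΨ_k` (48)." (p.8 L79 – p.9 L30; in (47) the
first `H_k` of `H_kH_k` is the accumulated coupling of (44), the second the one-step matrix of (46).)
§1.3.4 p.9 L35–42: *"Iterating this yields* `S_k(A, x, x′) = Σ_{j=0}^{k−1} L^{2(k−j)} Γ̃_j(A_{L^{k−j}}; L^{k−j}x, L^{k−j}x′)`
(50) *where* `Γ̃_j(A) = H_j(A)Γ_j(A)H_j(A)ᵀ` (51) *provided all the operators exist."*  BOS p.237 L15–18: *"Throughout we use the easily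
derived relation `Q_kQ_k* = I`, `∫dφ̄dφ e^{(φ̄,Aφ)} = det A`, the translation formula
`∫f(φ̄ + χ̄, φ + χ)dφ̄dφ = ∫f(φ̄, φ)dφ̄dφ`, and `∫dφ̄dφ exp[(φ̄,Aφ) + (J̄,φ) + (φ̄,J)] = det A e^{−(J̄,A⁻¹J)}`."*

**Dictionary.** The tree's block-spin transformation `fermionBlockRG R a Q Q̄`
(`WilsonFermionBlockAveraging.lean`, BOS (1.1) without the constant `N`) is
`(Tρ)(χ̄, χ) = ∫dψ̄dψ e^{−a Σ_y (χ̄_y − (ψ̄Q̄)_y)(χ_y − (Qψ)_y)} ρ(ψ̄, ψ)`, fine fermions indexed by `m`,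
block fermions by `n`; `a` is Dimock's `b_k`, `Q : Matrix n m R` his `Q_k(A)`, `Q̄ : Matrix m n R` his
`Q_k(−A)ᵀ`, `D` his `D_{e_k}(A) + m_k`; the tree's `fluctuationOp a Q Q̄ D = D + aQ̄Q =: F` is `D#_k(A)`
(39), `F⁻¹` is `S_k(A)`, the tree's `blockDirac a Q Q̄ D = a·1 − a²QF⁻¹Q̄ =: D₁` is `D_k(A)` (40), and
`fluctShiftMat = aF⁻¹Q̄ =: H`, `fluctShiftBarMat = aQF⁻¹ =: H̄` are the two halves of `H_k(A)` (40)
(`(χ̄H̄)_i = Σ_y χ̄_y (aQF⁻¹)_{yi}`, i.e. `b_kS_kᵀQ_k(A)ᵀ` acting on `Ψ̄_k`).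

**What is here (kernel-checked, zero `sorry`).**  Work in the tree's joint Grassmann algebra on
`BlockRGIdx n m = (n ⊕ₗ n) ⊕ₗ (m ⊕ₗ m)` (block fermions `χ̄, χ` first, fine fermions `ψ̄, ψ` second;
`chiBar/chi/psiBarF/psiF`), any commutative `ℚ`-algebra `R`.
* §1 **The change of variables** *"ψ → ψ + H_k(A)Ψ_k and similarly for ψ̄"*: the endomorphism
  `N = fluctShift R H H̄` of the generator space (`e_{ψ_j} ↦ Σ_y H_{jy}e_{χ_y}`,
  `e_{ψ̄_i} ↦ Σ_y H̄_{yi}e_{χ̄_y}`, block generators `↦ 0`), so that the algebra map `Λ(1 + N)` IS the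
  substitution (`map_one_add_fluctShift_psiF/psiBarF`: `ψ_j ↦ ψ_j + (Hχ)_j`, `ψ̄_i ↦ ψ̄_i + (χ̄H̄)_i`,
  block generators fixed); `N² = 0`, `(1 − N)(1 + N) = 1` (`one_sub_mul_one_add_fluctShift`), and `±N` are
  spectator shifts of the fine block (`isSpectatorShift_(neg_)fluctShift`), so the tree's translation
  invariance of the Berezin integral `IsSpectatorShift.berezinOn_map` (= BOS's translation formula)
  applies.
* §2 **"This diagonalizes the quadratic form"** — `blockRGExponent_add_quadratic_eq_shifted`:
  `−a Σ_y(χ̄−ψ̄Q̄)_y(χ−Qψ)_y − ψ̄Dψ = Λ(1 − N)(−ψ̄Fψ) − χ̄D₁χ` (`det F` a unit), i.e. the exponent is the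
  fine Gaussian `−ψ̄Fψ` in the shifted variables `ψ − Hχ, ψ̄ − χ̄H̄` plus the block action.
* §3 **(38) in the joint algebra** — `berezinOn_blockRGWeight_mul_gaussian_mul`:
  `∫dθ_{fine} e^{−a|χ−Qψ|²} · (e^{−ψ̄Dψ} f) = e^{−χ̄D₁χ} · ∫dθ_{fine} e^{−ψ̄Fψ} · Λ(1 + N)f` for EVERY
  element `f` of the fine algebra.
* §4 **(38) and (41) for the tree's linear map** — `fluctuationIntegral R a Q Q̄ D` (the unnormalised
  `f ↦ ∫dψ̄dψ e^{−ψ̄Fψ} f(ψ̄ + χ̄H̄, ψ + Hχ)`, an `R`-linear map `Λ(ψ̄,ψ) → Λ(χ̄,χ)`),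
  **`fermionBlockRG_grassmannExp_quadratic_mul`**:
  `fermionBlockRG R a Q Q̄ (e^{−ψ̄Dψ} · f) = e^{−χ̄D₁χ} · fluctuationIntegral R a Q Q̄ D f`, and
  **`fluctuationIntegral_one`**: `fluctuationIntegral R a Q Q̄ D 1 = ε det(−F) · 1` — Dimock's `Z_k(A)` (41)
  up to `M⁻¹_{k,b_k}`, `ε = (−1)^{|m|(|m|−1)/2}` the orientation sign of the tree's Berezin integral —
  which together re-derive the tree's `fermionBlockRG_grassmannExp_quadratic` (closing `example`).
* §5 **(43)–(44), the generating function, in an ambient algebra** —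
  **`berezinOn_blockWeight_mul_grassmannExp_quadratic_add_sources`**: in any `Λ(J)` with the fine
  fermions placed by `e : m ⊕ₗ m ↪o J` (`psiBarOf/psiOf` of `FermionBlockRGComposition.lean`), block field
  `Φ̄_y = ι(ab y)`, `Φ_y = ι(a y)` and sources `η̄_i = ι(vbar i)`, `η_j = ι(v j)` arbitrary degree-one
  spectators (so `η̄, η` anticommute with everything, as Dimock's auxiliary Grassmann algebra demands),
  `∫dθ_s e^{−c|Φ − QΨ|²} e^{−Ψ̄DΨ + Σ_i(η̄_iΨ_i + Ψ̄_iη_i)}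
     = ε det(−F) · e^{−Σ(D₁)_{yy'}Φ̄_yΦ_{y'} + Σ H_{iy} η̄_iΦ_y + Σ H̄_{yi} Φ̄_yη_i + Σ (F⁻¹)_{ij} η̄_iη_j}`
  — (44) with `Z_k ↦ ε det(−F)` (unnormalised), `S_k = F⁻¹`, and the SAME `H, H̄` as in §1 (a consistency
  check of (40)); proof as printed: the Gaussian integral with sources (the tree's
  `berezinOn_grassmannExp_quadratic_add_sources` = BOS's fourth formula of p.237) applied to the total
  sources `J̄ + η̄`, `J + η` of `FermionBlockRGComposition.blockExponent_add_quadratic_eq`.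
* §6 **The `η̄_iη_j`-coefficient of (44) for the tree's transformation** (one-step decomposition of the
  fermion two-point function, cf. BOS Theorem II.1): `fluctuationIntegral_psiBar_mul_psi`:
  `∫dψ̄dψ e^{−ψ̄Fψ}(ψ̄ + χ̄H̄)_i(ψ + Hχ)_j = ε adj(−F)_{ji}·1 + ε det(−F)·(χ̄H̄)_i(Hχ)_j` (no invertibility
  needed; odd moments vanish by the tree's charge rule, the pair moment is the tree's
  `berezin_grassmannExp_quadratic_mul_psiBar_mul_psi`), hence
  **`fermionBlockRG_grassmannExp_quadratic_mul_psiBar_mul_psi`**: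
  `T_{a,Q}(e^{−ψ̄Dψ}ψ̄_iψ_j) = e^{−χ̄D₁χ}·(ε adj(−F)_{ji}·1 + ε det(−F)·(χ̄H̄)_i(Hχ)_j)`.

* §7 **(45)–(48), the one-step flow of the generating function, and (50)–(51)** — `generatingFn Z D H H̄ S`
  (the form (44): `Z • exp(−(Ψ̄,DΨ) + (η̄,HΨ) + (Ψ̄H̄,η) + (η̄,Sη))`, field and sources arbitrary elements;
  `generatingFn_one_one_one_zero`: with `Z = 1, H = H̄ = I, S = 0` it is the integrand of (43));
  `berezinOn_blockWeight_mul_grassmannExp_sources_eq_generatingFn` ((44) = §5 in this vocabulary);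
  **`berezinOn_blockWeight_mul_generatingFn`**: one more Gaussian block-spin step maps
  `Ω[Z, D, H, H̄, S]` in the fine field (sources and block field degree-one spectators) to
  `Ω[Z·ε det(−F), c − c²QΓQ̄, H·(cΓQ̄), (cQΓ)·H̄, S + HΓH̄]` in the block field, `Γ = F⁻¹ = (D + cQ̄Q)⁻¹`
  — printed (46)–(48) without the rescaling `σ_L` (proof as printed: the couplings `(η̄,HΨ) + (Ψ̄H̄,η)`
  are fine sources with the composite spectators `η̄H`, `H̄η`, the factor `e^{(η̄,Sη)}` is a central
  spectator, and §5 performs Dimock's transformation `Ψ_k → Ψ_k + H_kΨ_{k+1}`);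
  `berezinOn_blockWeight_mul_generatingFn_init` ((44) is the first step from the initial convention);
  along a tower `𝓘 : ℕ → Type*` of lattices with weights `c k` and averaging operators `Qs k`, `Qbs k`
  the recursively defined flow `flowD ∕ flowGamma ∕ flowH ∕ flowHb ∕ flowS ∕ flowZ` ((46)–(48) iterated
  from `D_0 = D₀, H_0 = H̄_0 = I, S_0 = 0, Z_0 = 1`), `flowS_eq_sum` (**(50)–(51) unscaled**:
  `S_k = Σ_{j<k} H_jΓ_jH̄_j`), `generatingFn_flow_zero` and **`berezinOn_blockWeight_mul_generatingFn_flow`**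
  (the step `Ω_k → Ω_{k+1}` with the flow data).  The sources stay on the original lattice `𝓘 0`
  (Dimock moves them along with `(σ_L⁻¹)ᵀ` in (45)); all of Dimock's lattices `T^{−k}_{N+M−k}` have
  the same number of sites and `σ_L` is the weighted relabelling between them, so in the tree's
  coordinate-free setting (abstract finite index types, unweighted sums) the step is stated directly
  between the fine type `m` and the block type `n` and the conjugations by `σ_L` of (45) ∕ (47) are
  absent.  -- TODO(general form): the kernels (49)–(50) with the `L²` weights of the rescaled lattices.

* §8 **(42), gauge covariance** — *"All these objects are gauge covariant. In particular for a scalar `λ` …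
  `S_k(A + dλ) = e^{−ie_kλ} S_k(A) e^{ie_kλ}`"* (p.8 L54–56), with the covariance of the averaging and Dirac
  operators abstracted (as in the tree's `fluctuationOp_conj` ∕ `blockDirac_conj`) into conjugations
  `Q ↦ g′Qg⁻¹`, `Q̄ ↦ gQ̄g′⁻¹`, `D ↦ gDg⁻¹` by mutually inverse matrices: one step —
  `inv_fluctuationOp_conj` (`Γ ↦ gΓg⁻¹`), `det_neg_fluctuationOp_conj` (`Z` invariant), `fluctShiftMat_conj`
  (`H ↦ gHg′⁻¹`), `fluctShiftBarMat_conj` (`H̄ ↦ g′H̄g⁻¹`), `generatingFn_conj` (rotating the data = rotating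
  field and sources; pure bilinearity); along the tower with rotations `g k` on every level —
  `flowD_conj`, **`flowGamma_conj`**, `flowH_conj`, `flowHb_conj`, **`flowS_conj`** (`S_k ↦ g_0S_kg_0⁻¹`, printed
  (42)), `flowZ_conj` (`Z_k` invariant).
* §9 **(30) with the sources of (43), i.e. (45) iterated: `Ω_k = T_{k−1}⋯T_0 Ω_0`** in ONE ambient algebra
  carrying every level's fermions (level `k` placed by `es k : 𝓘 k ⊕ₗ 𝓘 k ↪o J`) — `iterGeneratingFn`
  (`Ω_0 =` the integrand of (43), `Ω_{k+1} = ∫dθ_{level k} e^{−c_k|Ψ_{k+1} − Q_kΨ_k|²} Ω_k`) and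
  **`iterGeneratingFn_eq_generatingFn`**: if consecutive levels sit on distinct generators, the sources
  avoid every level and `det F_j` is a unit for `j < k` (*"provided all the operators exist"*), then
  `Ω_k = Ω[Z_k, D_k, H_k, H̄_k, S_k](Ψ̄_k, Ψ_k; η̄, η)` with the flow data of §7 — Dimock's *"The formula (30)
  is again proved by induction"* (p.7 L61), here with sources.

**Design.** Dimock's normalised Gaussian measure `dμ_{S}` with covariance `S = F⁻¹` is represented,
as everywhere in this cluster, by the unnormalised Berezin functional `f ↦ ∫dψ̄dψ e^{−ψ̄Fψ} f`; its value
on `1` (`fluctuationIntegral_one`) is the normalisation, so `⟨g⟩_{S} = (ε det(−F))⁻¹ ∫ e^{−ψ̄Fψ} g`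
whenever `det F` is a unit — no division is performed here.  The substitution `f(ψ) ↦ f(ψ + Hχ)` is
the functorial action `ExteriorAlgebra.map (1 + N)` of the unipotent `1 + N` on the joint exterior
algebra, which is an algebra automorphism with inverse `ExteriorAlgebra.map (1 − N)` since `N² = 0`.
Gauge fields, the covariant averaging `Q_k(A)` (37) and the smallness condition on `e_k|∂A|` enter
only through the hypothesis `IsUnit (det F)` (Dimock: *"this operator is invertible (about which more
later)"*), exactly as in the tree's `fermionBlockRG_grassmannExp_quadratic`.

**What is NOT here.** The rescaling `σ_L` in (45) ∕ (47) and the rescaled kernels (49) ∕ (50) (see §7); the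
covariance `Q_k(A + dλ) = e^{ie_kλ}Q_k(A)e^{−ie_kλ′}` of the concrete averaging operators (37) themselves (§8
takes it as the conjugation hypothesis; the torus Wilson case is the tree's `fermionBlockAvg_gaugeTransform`);
the invertibility of `D#_k(A)` for small `e_k|∂A|` and the bounds (52)–(53) (§1.3.4); the normalisation
constants `M_{k,b}` (the tree's `BlockFermionRG` treats `berezin ∘ fermionBlockRG`).
-/

noncomputable section

open Finset Matrix

namespace Literature.MathematicalPhysics.QuantumLattice

section QLatticeAQFT

namespace FermionBlockRG

open GrassmannAlgebra ExteriorAlgebra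

variable (R : Type*) [CommRing R]
variable {m n : Type*} [LinearOrder m] [Fintype m] [LinearOrder n] [Fintype n]

/-! ### §1 The fluctuation shift `ψ → ψ + Hχ`, `ψ̄ → ψ̄ + χ̄H̄` (Dimock p.8 L46) -/

/-- `(Hχ)_j` as a vector of the joint generator space: `Σ_y H_{jy} e_{χ_y}` (plumbing for
`fluctShift`). [folklore] -/
def fluctShiftVec (H : Matrix m n R) (j : m) : BlockRGIdx n m → R :=
  ∑ y, H j y • (Pi.single (inlLex (n ⊕ₗ n) (m ⊕ₗ m) (toLex (Sum.inr y))) 1 : BlockRGIdx n m → R)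

/-- `(χ̄H̄)_i` as a vector of the joint generator space: `Σ_y H̄_{yi} e_{χ̄_y}` (plumbing for
`fluctShift`). [folklore] -/
def fluctShiftBarVec (Hb : Matrix n m R) (i : m) : BlockRGIdx n m → R :=
  ∑ y, Hb y i • (Pi.single (inlLex (n ⊕ₗ n) (m ⊕ₗ m) (toLex (Sum.inl y))) 1 : BlockRGIdx n m → R)

/-- **Dimock's change of variables** *"ψ → ψ + H_k(A)Ψ_k and similarly for ψ̄"* (p.8 L46) as the
endomorphism `N` of the generator space of the joint algebra: `e_{ψ_j} ↦ (Hχ)_j`, `e_{ψ̄_i} ↦ (χ̄H̄)_i`,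
`e_{χ̄}, e_{χ} ↦ 0`; the substitution itself is the algebra map `Λ(1 + N)` (`ExteriorAlgebra.map`), its
inverse `Λ(1 − N)`.  Here `H : Matrix m n R`, `H̄ : Matrix n m R` are arbitrary; Dimock's values are
`fluctShiftMat`, `fluctShiftBarMat` below. [cite: Dimock2004QED3TorusII, §1.3.2 p.8 L46 (proof of (38))] -/
def fluctShift (H : Matrix m n R) (Hb : Matrix n m R) : Module.End R (BlockRGIdx n m → R) :=
  ∑ j, (LinearMap.proj (inrLex (n ⊕ₗ n) (m ⊕ₗ m) (toLex (Sum.inr j)))).smulRight (fluctShiftVec R H j) +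
    ∑ i, (LinearMap.proj (inrLex (n ⊕ₗ n) (m ⊕ₗ m) (toLex (Sum.inl i)))).smulRight (fluctShiftBarVec R Hb i)

omit [Fintype m] in
/-- `ι((Hχ)_j) = Σ_y H_{jy} χ_y`. [folklore] -/
private theorem ι_fluctShiftVec (H : Matrix m n R) (j : m) :
    ι R (fluctShiftVec R H j) = ∑ y, H j y • chi (R := R) (m := m) y := by
  simp only [fluctShiftVec, map_sum, map_smul, chi, gen]

omit [Fintype m] in
/-- `ι((χ̄H̄)_i) = Σ_y H̄_{yi} χ̄_y`. [folklore] -/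
private theorem ι_fluctShiftBarVec (Hb : Matrix n m R) (i : m) :
    ι R (fluctShiftBarVec R Hb i) = ∑ y, Hb y i • chiBar (R := R) (m := m) y := by
  simp only [fluctShiftBarVec, map_sum, map_smul, chiBar, gen]

omit [Fintype m] in
/-- The shift vectors live on the block generators. [folklore] -/
private theorem fluctShiftVec_apply_inrLex (H : Matrix m n R) (j : m) (k : m ⊕ₗ m) :
    fluctShiftVec R H j (inrLex (n ⊕ₗ n) (m ⊕ₗ m) k) = 0 := by
  simp only [fluctShiftVec, Finset.sum_apply, Pi.smul_apply, Pi.single_apply, (inlLex_ne_inrLex _ k).symm,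
    if_false, smul_zero, Finset.sum_const_zero]

omit [Fintype m] in
/-- The shift vectors live on the block generators. [folklore] -/
private theorem fluctShiftBarVec_apply_inrLex (Hb : Matrix n m R) (i : m) (k : m ⊕ₗ m) :
    fluctShiftBarVec R Hb i (inrLex (n ⊕ₗ n) (m ⊕ₗ m) k) = 0 := by
  simp only [fluctShiftBarVec, Finset.sum_apply, Pi.smul_apply, Pi.single_apply, (inlLex_ne_inrLex _ k).symm,
    if_false, smul_zero, Finset.sum_const_zero]

/-- `N w = Σ_j w(ψ_j)·(Hχ)_j + Σ_i w(ψ̄_i)·(χ̄H̄)_i`. [cite: Dimock2004QED3TorusII, §1.3.2 p.8 L46 (proof of (38))] -/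
theorem fluctShift_apply (H : Matrix m n R) (Hb : Matrix n m R) (w : BlockRGIdx n m → R) :
    fluctShift R H Hb w = ∑ j, w (inrLex (n ⊕ₗ n) (m ⊕ₗ m) (toLex (Sum.inr j))) • fluctShiftVec R H j +
      ∑ i, w (inrLex (n ⊕ₗ n) (m ⊕ₗ m) (toLex (Sum.inl i))) • fluctShiftBarVec R Hb i := by
  simp only [fluctShift, LinearMap.add_apply, LinearMap.sum_apply, LinearMap.smulRight_apply,
    LinearMap.proj_apply]

/-- `N` kills the block generators and maps the fine generators into block generators: it is a
SPECTATOR SHIFT of the fine block in the sense of the tree's translation invariance of the Berezin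
integral (`IsSpectatorShift`; BOS p.237 L17: *"the translation formula
`∫f(φ̄ + χ̄, φ + χ)dφ̄dφ = ∫f(φ̄, φ)dφ̄dφ`"*). [cite: BalabanOcarrollSchor1989, §II p.237 L17 (translation formula)] -/
theorem isSpectatorShift_fluctShift (H : Matrix m n R) (Hb : Matrix n m R) :
    IsSpectatorShift R (Finset.univ.map (inrLex (n ⊕ₗ n) (m ⊕ₗ m)).toEmbedding) (fluctShift R H Hb) := by
  refine ⟨fun x hx => ?_, fun y x hx => ?_⟩
  · rw [fluctShift_apply]
    have h1 : ∀ k, (Pi.single x (1 : R) : BlockRGIdx n m → R) (inrLex (n ⊕ₗ n) (m ⊕ₗ m) k) = 0 :=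
      fun k => Pi.single_eq_of_ne (fun h : inrLex (n ⊕ₗ n) (m ⊕ₗ m) k = x =>
        hx (Finset.mem_map.2 ⟨k, Finset.mem_univ k, h⟩)) _
    simp only [h1, zero_smul, Finset.sum_const_zero, add_zero]
  · obtain ⟨k, -, rfl⟩ := Finset.mem_map.1 hx
    rw [fluctShift_apply]
    simp only [Pi.add_apply, Finset.sum_apply, Pi.smul_apply, RelEmbedding.coe_toEmbedding,
      fluctShiftVec_apply_inrLex, fluctShiftBarVec_apply_inrLex, smul_zero, Finset.sum_const_zero, add_zero]

/-- `N e_{ψ_j} = (Hχ)_j`. [folklore] -/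
private theorem fluctShift_single_psiF (H : Matrix m n R) (Hb : Matrix n m R) (j : m) :
    fluctShift R H Hb (Pi.single (inrLex (n ⊕ₗ n) (m ⊕ₗ m) (toLex (Sum.inr j))) 1) = fluctShiftVec R H j := by
  rw [fluctShift_apply]
  have h1 : ∀ j', (Pi.single (inrLex (n ⊕ₗ n) (m ⊕ₗ m) (toLex (Sum.inr j))) (1 : R) :
      BlockRGIdx n m → R) (inrLex (n ⊕ₗ n) (m ⊕ₗ m) (toLex (Sum.inr j'))) = if j' = j then 1 else 0 :=
    fun j' => by simp only [Pi.single_apply, EmbeddingLike.apply_eq_iff_eq, Sum.inr.injEq]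
  have h2 : ∀ i, (Pi.single (inrLex (n ⊕ₗ n) (m ⊕ₗ m) (toLex (Sum.inr j))) (1 : R) :
      BlockRGIdx n m → R) (inrLex (n ⊕ₗ n) (m ⊕ₗ m) (toLex (Sum.inl i))) = 0 := fun i => by simp
  simp only [h1, h2, zero_smul, Finset.sum_const_zero, add_zero, ite_smul, one_smul, Finset.sum_ite_eq',
    Finset.mem_univ, if_true]

/-- `N e_{ψ̄_i} = (χ̄H̄)_i`. [folklore] -/
private theorem fluctShift_single_psiBarF (H : Matrix m n R) (Hb : Matrix n m R) (i : m) :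
    fluctShift R H Hb (Pi.single (inrLex (n ⊕ₗ n) (m ⊕ₗ m) (toLex (Sum.inl i))) 1) = fluctShiftBarVec R Hb i := by
  rw [fluctShift_apply]
  have h1 : ∀ i', (Pi.single (inrLex (n ⊕ₗ n) (m ⊕ₗ m) (toLex (Sum.inl i))) (1 : R) :
      BlockRGIdx n m → R) (inrLex (n ⊕ₗ n) (m ⊕ₗ m) (toLex (Sum.inl i'))) = if i' = i then 1 else 0 :=
    fun i' => by simp only [Pi.single_apply, EmbeddingLike.apply_eq_iff_eq, Sum.inl.injEq]
  have h2 : ∀ j, (Pi.single (inrLex (n ⊕ₗ n) (m ⊕ₗ m) (toLex (Sum.inl i))) (1 : R) :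
      BlockRGIdx n m → R) (inrLex (n ⊕ₗ n) (m ⊕ₗ m) (toLex (Sum.inr j))) = 0 := fun j => by simp
  simp only [h1, h2, zero_smul, Finset.sum_const_zero, zero_add, ite_smul, one_smul, Finset.sum_ite_eq',
    Finset.mem_univ, if_true]

/-- `N² = 0` (the shift maps fine generators to block generators and kills those). [cite: Dimock2004QED3TorusII, §1.3.2 p.8 L46 (proof of (38))] -/
theorem fluctShift_comp_fluctShift (H : Matrix m n R) (Hb : Matrix n m R) :
    fluctShift R H Hb ∘ₗ fluctShift R H Hb = 0 := by
  refine LinearMap.ext fun v => ?_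
  rw [LinearMap.comp_apply, LinearMap.zero_apply, fluctShift_apply R H Hb (fluctShift R H Hb v)]
  simp only [fluctShift_apply, Pi.add_apply, Finset.sum_apply, Pi.smul_apply, fluctShiftVec_apply_inrLex,
    fluctShiftBarVec_apply_inrLex, smul_zero, Finset.sum_const_zero, add_zero, zero_smul]

/-- `(1 − N)(1 + N) = 1`: the substitution `ψ → ψ − Hχ` inverts `ψ → ψ + Hχ`. [cite: Dimock2004QED3TorusII, §1.3.2 p.8 L46 (proof of (38))] -/
theorem one_sub_mul_one_add_fluctShift (H : Matrix m n R) (Hb : Matrix n m R) :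
    (1 + -fluctShift R H Hb) * (1 + fluctShift R H Hb) = 1 := by
  have h0 : -fluctShift R H Hb * fluctShift R H Hb = 0 := by
    rw [Module.End.mul_eq_comp, LinearMap.neg_comp, fluctShift_comp_fluctShift, neg_zero]
  rw [add_mul, one_mul, mul_add, mul_one, h0, add_zero, add_neg_cancel_right]

/-- `−N` (the inverse substitution `ψ → ψ − Hχ`) is a spectator shift of the fine block as well.
[cite: BalabanOcarrollSchor1989, §II p.237 L17 (translation formula)] -/
theorem isSpectatorShift_neg_fluctShift (H : Matrix m n R) (Hb : Matrix n m R) :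
    IsSpectatorShift R (Finset.univ.map (inrLex (n ⊕ₗ n) (m ⊕ₗ m)).toEmbedding) (-fluctShift R H Hb) := by
  have h := isSpectatorShift_fluctShift R H Hb
  refine ⟨fun x hx => ?_, fun y x hx => ?_⟩
  · rw [LinearMap.neg_apply, h.apply_single_of_not_mem x hx, neg_zero]
  · rw [LinearMap.neg_apply, Pi.neg_apply, h.apply_single_apply_of_mem y x hx, neg_zero]

/-- **`ψ_j → ψ_j + (Hχ)_j`** under `Λ(1 + N)`. [cite: Dimock2004QED3TorusII, §1.3.2 p.8 L46 (proof of (38))] -/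
theorem map_one_add_fluctShift_psiF (H : Matrix m n R) (Hb : Matrix n m R) (j : m) :
    ExteriorAlgebra.map (1 + fluctShift R H Hb) (psiF (n := n) j) =
      psiF j + ∑ y, H j y • chi (R := R) (m := m) y := by
  rw [psiF, map_one_add_gen, fluctShift_single_psiF, ι_fluctShiftVec]

/-- **`ψ̄_i → ψ̄_i + (χ̄H̄)_i`** under `Λ(1 + N)`. [cite: Dimock2004QED3TorusII, §1.3.2 p.8 L46 (proof of (38))] -/
theorem map_one_add_fluctShift_psiBarF (H : Matrix m n R) (Hb : Matrix n m R) (i : m) :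
    ExteriorAlgebra.map (1 + fluctShift R H Hb) (psiBarF (n := n) i) =
      psiBarF i + ∑ y, Hb y i • chiBar (R := R) (m := m) y := by
  rw [psiBarF, map_one_add_gen, fluctShift_single_psiBarF, ι_fluctShiftBarVec]

/-- `ψ_j → ψ_j − (Hχ)_j` under `Λ(1 − N)`. [cite: Dimock2004QED3TorusII, §1.3.2 p.8 L46 (proof of (38))] -/
theorem map_one_add_neg_fluctShift_psiF (H : Matrix m n R) (Hb : Matrix n m R) (j : m) :
    ExteriorAlgebra.map (1 + -fluctShift R H Hb) (psiF (n := n) j) =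
      psiF j - ∑ y, H j y • chi (R := R) (m := m) y := by
  rw [psiF, map_one_add_gen, LinearMap.neg_apply, fluctShift_single_psiF, map_neg, ι_fluctShiftVec,
    ← sub_eq_add_neg]

/-- `ψ̄_i → ψ̄_i − (χ̄H̄)_i` under `Λ(1 − N)`. [cite: Dimock2004QED3TorusII, §1.3.2 p.8 L46 (proof of (38))] -/
theorem map_one_add_neg_fluctShift_psiBarF (H : Matrix m n R) (Hb : Matrix n m R) (i : m) :
    ExteriorAlgebra.map (1 + -fluctShift R H Hb) (psiBarF (n := n) i) =
      psiBarF i - ∑ y, Hb y i • chiBar (R := R) (m := m) y := by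
  rw [psiBarF, map_one_add_gen, LinearMap.neg_apply, fluctShift_single_psiBarF, map_neg, ι_fluctShiftBarVec,
    ← sub_eq_add_neg]

variable [Algebra ℚ R]

/-! ### §2 Completing the square: *"This diagonalizes the quadratic form"* (Dimock p.8 L46–48) -/

omit [Algebra ℚ R] in
/-- Re-summation `Σ_{ij} F_{ij} (χ̄H̄)_i ψ_j = Σ_j (χ̄H̄F)_j ψ_j`. [folklore] -/
private theorem sum_sum_smul_bar_mul_psiF (F : Matrix m m R) (Hb : Matrix n m R) :
    ∑ i, ∑ j, F i j • ((∑ y, Hb y i • chiBar (R := R) (m := m) y) * psiF j) =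
      ∑ j, (∑ y, (Hb * F) y j • chiBar (R := R) (m := m) y) * psiF j := by
  simp only [Finset.sum_mul, smul_mul_assoc, Finset.smul_sum, smul_smul, Matrix.mul_apply, Finset.sum_smul]
  rw [Finset.sum_comm]
  refine Finset.sum_congr rfl fun j _ => ?_
  rw [Finset.sum_comm]
  refine Finset.sum_congr rfl fun y _ => Finset.sum_congr rfl fun i _ => ?_
  rw [mul_comm]

omit [Algebra ℚ R] in
/-- Re-summation `Σ_{ij} F_{ij} ψ̄_i (Hχ)_j = Σ_i ψ̄_i (FHχ)_i`. [folklore] -/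
private theorem sum_sum_smul_psiBarF_mul (F : Matrix m m R) (H : Matrix m n R) :
    ∑ i, ∑ j, F i j • (psiBarF i * ∑ y, H j y • chi (R := R) (m := m) y) =
      ∑ i, psiBarF i * ∑ y, (F * H) i y • chi (R := R) (m := m) y := by
  simp only [Finset.mul_sum, mul_smul_comm, Finset.smul_sum, smul_smul, Matrix.mul_apply, Finset.sum_smul]
  refine Finset.sum_congr rfl fun i _ => ?_
  rw [Finset.sum_comm]

omit [Algebra ℚ R] in
/-- Re-summation `Σ_{ij} F_{ij} (χ̄H̄)_i (Hχ)_j = Σ_{yy'} (H̄FH)_{yy'} χ̄_y χ_{y'}`. [folklore] -/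
private theorem sum_sum_smul_bar_mul_chi (F : Matrix m m R) (Hb : Matrix n m R) (H : Matrix m n R) :
    ∑ i, ∑ j, F i j • ((∑ y, Hb y i • chiBar (R := R) (m := m) y) * ∑ y', H j y' • chi y') =
      ∑ y, ∑ y', (Hb * F * H) y y' • (chiBar (R := R) (m := m) y * chi y') := by
  simp only [Finset.sum_mul_sum, smul_mul_smul_comm, Finset.smul_sum, smul_smul]
  simp only [Matrix.mul_apply, Finset.sum_mul, Finset.sum_smul]
  -- LHS Σ_i Σ_j Σ_y Σ_y' ; RHS Σ_y Σ_y' Σ_j Σ_i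
  calc ∑ i, ∑ j, ∑ y, ∑ y', (F i j * (Hb y i * H j y')) • (chiBar (R := R) (m := m) y * chi y')
      = ∑ i, ∑ y, ∑ j, ∑ y', (F i j * (Hb y i * H j y')) • (chiBar (R := R) (m := m) y * chi y') :=
        Finset.sum_congr rfl fun _ _ => Finset.sum_comm
    _ = ∑ y, ∑ i, ∑ j, ∑ y', (F i j * (Hb y i * H j y')) • (chiBar (R := R) (m := m) y * chi y') :=
        Finset.sum_comm
    _ = ∑ y, ∑ i, ∑ y', ∑ j, (F i j * (Hb y i * H j y')) • (chiBar (R := R) (m := m) y * chi y') :=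
        Finset.sum_congr rfl fun _ _ => Finset.sum_congr rfl fun _ _ => Finset.sum_comm
    _ = ∑ y, ∑ y', ∑ i, ∑ j, (F i j * (Hb y i * H j y')) • (chiBar (R := R) (m := m) y * chi y') :=
        Finset.sum_congr rfl fun _ _ => Finset.sum_comm
    _ = ∑ y, ∑ y', ∑ j, ∑ i, (F i j * (Hb y i * H j y')) • (chiBar (R := R) (m := m) y * chi y') :=
        Finset.sum_congr rfl fun _ _ => Finset.sum_congr rfl fun _ _ => Finset.sum_comm
    _ = _ := by
        refine Finset.sum_congr rfl fun y _ => Finset.sum_congr rfl fun y' _ =>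
          Finset.sum_congr rfl fun j _ => Finset.sum_congr rfl fun i _ => ?_
        ring_nf

/-- **Dimock (40), `H_k(A) = b_k S_k(A) Q_k(−A)ᵀ` on `Ψ_k`**: the shift matrix `H = a F⁻¹ Q̄`
(`F = D + aQ̄Q` the tree's `fluctuationOp` = Dimock's `D#_k(A)` of (39), `S_k = (D#_k)⁻¹`).
[cite: Dimock2004QED3TorusII, §1.3.2 (40) p.8] -/
def fluctShiftMat (a : R) (Q : Matrix n m R) (Qb : Matrix m n R) (D : Matrix m m R) : Matrix m n R :=
  a • ((fluctuationOp a Q Qb D)⁻¹ * Qb)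

/-- **Dimock (40), `H_k(A) = b_k S_k(A)ᵀ Q_k(A)ᵀ` on `Ψ̄_k`**: the shift matrix `H̄ = a Q F⁻¹` acting on
`χ̄` from the right, `(χ̄H̄)_i = Σ_y χ̄_y H̄_{yi}`. [cite: Dimock2004QED3TorusII, §1.3.2 (40) p.8] -/
def fluctShiftBarMat (a : R) (Q : Matrix n m R) (Qb : Matrix m n R) (D : Matrix m m R) : Matrix n m R :=
  a • (Q * (fluctuationOp a Q Qb D)⁻¹)

omit [Algebra ℚ R] in
/-- **Completing the square** (Dimock p.8 L46–48: *"To prove (38) make the transformation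
`ψ → ψ + H_k(A)Ψ_k` and similarly for `ψ̄`. This diagonalizes the quadratic form and gives
`(Ψ̄_k, D_k(A)Ψ_k) + (ψ̄, D#_k(A)ψ)`"*): in the joint algebra, for `F = D + aQ̄Q` with `det F` a unit,
`−a Σ_y (χ̄ − ψ̄Q̄)_y (χ − Qψ)_y − ψ̄Dψ = Λ(1 − N)(−ψ̄Fψ) − χ̄D₁χ`,
i.e. `= −(ψ̄ − χ̄H̄) F (ψ − Hχ) − χ̄D₁χ` with `H = aF⁻¹Q̄`, `H̄ = aQF⁻¹`, `D₁ = a − a²QF⁻¹Q̄` (`blockDirac`,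
Dimock's `D_k(A)` of (40)). [cite: Dimock2004QED3TorusII, §1.3.2 p.8 L46 (proof of (38))] -/
theorem blockRGExponent_add_quadratic_eq_shifted (a : R) (Q : Matrix n m R) (Qb : Matrix m n R)
    (D : Matrix m m R) (hF : IsUnit (fluctuationOp a Q Qb D).det) :
    blockRGExponent R a Q Qb +
        ExteriorAlgebra.map (Function.ExtendByZero.linearMap R (inrLex (n ⊕ₗ n) (m ⊕ₗ m)))
          (quadratic R (-D)) =
      ExteriorAlgebra.map (1 + -fluctShift R (fluctShiftMat R a Q Qb D) (fluctShiftBarMat R a Q Qb D))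
          (ExteriorAlgebra.map (Function.ExtendByZero.linearMap R (inrLex (n ⊕ₗ n) (m ⊕ₗ m)))
            (quadratic R (-(fluctuationOp a Q Qb D)))) +
        ExteriorAlgebra.map (Function.ExtendByZero.linearMap R (inlLex (n ⊕ₗ n) (m ⊕ₗ m)))
          (quadratic R (-blockDirac a Q Qb D)) := by
  set F := fluctuationOp a Q Qb D with hFdef
  set H := fluctShiftMat R a Q Qb D with hH
  set Hb := fluctShiftBarMat R a Q Qb D with hHb
  have hFinv : F * F⁻¹ = 1 := Matrix.mul_nonsing_inv _ hF
  have hinvF : F⁻¹ * F = 1 := Matrix.nonsing_inv_mul _ hF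
  have hHbF : Hb * F = a • Q := by
    rw [hHb, fluctShiftBarMat, ← hFdef, Matrix.smul_mul, Matrix.mul_assoc, hinvF, Matrix.mul_one]
  have hFH : F * H = a • Qb := by
    rw [hH, fluctShiftMat, ← hFdef, Matrix.mul_smul, ← Matrix.mul_assoc, hFinv, Matrix.one_mul]
  have hHbFH : Hb * F * H = (a ^ 2) • (Q * F⁻¹ * Qb) := by
    rw [hHbF, hH, fluctShiftMat, ← hFdef, Matrix.smul_mul, Matrix.mul_smul, smul_smul, ← pow_two,
      Matrix.mul_assoc]
  -- expand the shifted quadratic form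
  have hexp : ExteriorAlgebra.map (1 + -fluctShift R H Hb)
      (ExteriorAlgebra.map (Function.ExtendByZero.linearMap R (inrLex (n ⊕ₗ n) (m ⊕ₗ m)))
        (quadratic R (-F))) =
      ExteriorAlgebra.map (Function.ExtendByZero.linearMap R (inrLex (n ⊕ₗ n) (m ⊕ₗ m)))
          (quadratic R (-F)) +
        ∑ x, (ExteriorAlgebra.ι R (blockSrcBar R a Q x) * psiF x +
          psiBarF x * ExteriorAlgebra.ι R (blockSrc R a Qb x)) -
        ExteriorAlgebra.map (Function.ExtendByZero.linearMap R (inlLex (n ⊕ₗ n) (m ⊕ₗ m)))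
          (quadratic R ((a ^ 2) • (Q * F⁻¹ * Qb))) := by
    rw [map_inrLex_quadratic, map_sum]
    simp only [map_sum, map_smul, map_mul, map_one_add_neg_fluctShift_psiF,
      map_one_add_neg_fluctShift_psiBarF]
    -- Σ_ij (-F)_ij • ((ψ̄_i - b̄_i) * (ψ_j - b_j))
    have e1 : ∑ i, ∑ j, (-F) i j • ((psiBarF (R := R) (n := n) i - ∑ y, Hb y i • chiBar y) *
        (psiF j - ∑ y, H j y • chi y)) =
        ∑ i, ∑ j, (-F) i j • (psiBarF (R := R) (n := n) i * psiF j) -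
          ∑ i, ∑ j, (-F) i j • ((∑ y, Hb y i • chiBar (R := R) (m := m) y) * psiF j) -
          ∑ i, ∑ j, (-F) i j • (psiBarF i * ∑ y, H j y • chi (R := R) (m := m) y) +
          ∑ i, ∑ j, (-F) i j • ((∑ y, Hb y i • chiBar (R := R) (m := m) y) * ∑ y', H j y' • chi y') := by
      simp only [sub_mul, mul_sub, smul_sub, Finset.sum_sub_distrib]
      abel
    rw [e1, sum_sum_smul_bar_mul_psiF, sum_sum_smul_psiBarF_mul, sum_sum_smul_bar_mul_chi,
      ← map_inrLex_quadratic]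
    have e2 : Hb * -F = -(a • Q) := by rw [Matrix.mul_neg, hHbF]
    have e3 : -F * H = -(a • Qb) := by rw [Matrix.neg_mul, hFH]
    have e4 : Hb * -F * H = -((a ^ 2) • (Q * F⁻¹ * Qb)) := by rw [Matrix.mul_neg, Matrix.neg_mul, hHbFH]
    rw [e4, e2, e3]
    have e5 : ∑ j, (∑ y, (-(a • Q)) y j • chiBar (R := R) (m := m) y) * psiF j =
        -∑ x, ExteriorAlgebra.ι R (blockSrcBar R a Q x) * psiF x := by
      simp only [ι_blockSrcBar, Matrix.neg_apply, Matrix.smul_apply, smul_eq_mul, neg_smul,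
        Finset.sum_neg_distrib, neg_mul]
    have e6 : ∑ i, psiBarF i * ∑ y, (-(a • Qb)) i y • chi (R := R) (m := m) y =
        -∑ x, psiBarF x * ExteriorAlgebra.ι R (blockSrc R a Qb x) := by
      simp only [ι_blockSrc, Matrix.neg_apply, Matrix.smul_apply, smul_eq_mul, neg_smul,
        Finset.sum_neg_distrib, mul_neg]
    have e7 : ∑ y, ∑ y', (-((a ^ 2) • (Q * F⁻¹ * Qb))) y y' • (chiBar (R := R) (m := m) y * chi y') =
        -ExteriorAlgebra.map (Function.ExtendByZero.linearMap R (inlLex (n ⊕ₗ n) (m ⊕ₗ m)))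
          (quadratic R ((a ^ 2) • (Q * F⁻¹ * Qb))) := by
      rw [map_inlLex_quadratic, ← Finset.sum_neg_distrib]
      refine Finset.sum_congr rfl fun y _ => ?_
      rw [← Finset.sum_neg_distrib]
      refine Finset.sum_congr rfl fun y' _ => ?_
      rw [Matrix.neg_apply, neg_smul]
    rw [e5, e6, e7, Finset.sum_add_distrib]
    abel
  rw [hexp, blockRGExponent_eq]
  have hA : ExteriorAlgebra.map (Function.ExtendByZero.linearMap R (inrLex (n ⊕ₗ n) (m ⊕ₗ m)))
        (quadratic R (-(a • (Qb * Q)))) +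
      ExteriorAlgebra.map (Function.ExtendByZero.linearMap R (inrLex (n ⊕ₗ n) (m ⊕ₗ m)))
        (quadratic R (-D)) =
      ExteriorAlgebra.map (Function.ExtendByZero.linearMap R (inrLex (n ⊕ₗ n) (m ⊕ₗ m)))
        (quadratic R (-F)) := by
    rw [← map_add, ← quadratic_add]
    congr 2
    rw [hFdef, fluctuationOp]; abel
  have hB : ExteriorAlgebra.map (Function.ExtendByZero.linearMap R (inlLex (n ⊕ₗ n) (m ⊕ₗ m)))
        (quadratic R (-blockDirac a Q Qb D)) =
      ExteriorAlgebra.map (Function.ExtendByZero.linearMap R (inlLex (n ⊕ₗ n) (m ⊕ₗ m)))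
          (quadratic R (-(a • (1 : Matrix n n R)))) +
        ExteriorAlgebra.map (Function.ExtendByZero.linearMap R (inlLex (n ⊕ₗ n) (m ⊕ₗ m)))
          (quadratic R ((a ^ 2) • (Q * F⁻¹ * Qb))) := by
    rw [← map_add, ← quadratic_add]
    congr 2
    rw [blockDirac, ← hFdef, neg_sub, sub_eq_neg_add]
  rw [hB, ← hA]
  abel

/-! ### §3 Dimock (38): the block-spin transformation of a Gaussian times an arbitrary density -/

/-- **Dimock (38) in the joint algebra**: for ANY density `f` of the fine fermions and any action `D`
whose fluctuation operator `F = D + aQ̄Q` has unit determinant,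
`∫dψ̄dψ e^{−a Σ_y (χ̄−ψ̄Q̄)_y(χ−Qψ)_y} e^{−ψ̄Dψ} f(ψ̄, ψ) = e^{−χ̄D₁χ} · ∫dψ̄dψ e^{−ψ̄Fψ} f(ψ̄ + χ̄H̄, ψ + Hχ)`
— printed: *"`∫ dψ M⁻¹_{k,b_k} exp(−b_k|Ψ_k − Q_k(A)ψ|²) exp(−(ψ̄, (D_{e_k}(A) + m_k)ψ)) f(ψ)
 = Z_k(A) exp(−(Ψ̄_k, D_k(A)Ψ_k)) ∫ f(ψ + H_k(A)Ψ_k) dμ_{S_k(A)}(ψ)` (38)"* with (39)–(41); here without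
the normalisations `M⁻¹_{k,b_k}` and `Z_k(A)` (the fine Gaussian integral is left unnormalised, cf.
`fluctuationIntegral_one`).  Proof as printed (p.8 L46–48): complete the square
(`blockRGExponent_add_quadratic_eq_shifted`), undo the shift inside the fine Berezin integral by the
translation formula (`IsSpectatorShift.berezinOn_map` for `−N`, using `(1 − N)(1 + N) = 1` on `f`), and
pull the block Gaussian — a central spectator fixed by the shift — out of the integral. [cite: Dimock2004QED3TorusII, §1.3.2 (38) p.8] -/
theorem berezinOn_blockRGWeight_mul_gaussian_mul (a : R) (Q : Matrix n m R) (Qb : Matrix m n R)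
    (D : Matrix m m R) (hF : IsUnit (fluctuationOp a Q Qb D).det) (f : GrassmannAlgebra R (m ⊕ₗ m)) :
    berezinOn R (Finset.univ.map (inrLex (n ⊕ₗ n) (m ⊕ₗ m)).toEmbedding)
        (blockRGWeight R a Q Qb *
          ExteriorAlgebra.map (Function.ExtendByZero.linearMap R (inrLex (n ⊕ₗ n) (m ⊕ₗ m)))
            (grassmannExp (quadratic R (-D)) * f)) =
      ExteriorAlgebra.map (Function.ExtendByZero.linearMap R (inlLex (n ⊕ₗ n) (m ⊕ₗ m)))
          (grassmannExp (quadratic R (-blockDirac a Q Qb D))) *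
        berezinOn R (Finset.univ.map (inrLex (n ⊕ₗ n) (m ⊕ₗ m)).toEmbedding)
          (ExteriorAlgebra.map (Function.ExtendByZero.linearMap R (inrLex (n ⊕ₗ n) (m ⊕ₗ m)))
              (grassmannExp (quadratic R (-fluctuationOp a Q Qb D))) *
            ExteriorAlgebra.map (1 + fluctShift R (fluctShiftMat R a Q Qb D) (fluctShiftBarMat R a Q Qb D))
              (ExteriorAlgebra.map (Function.ExtendByZero.linearMap R (inrLex (n ⊕ₗ n) (m ⊕ₗ m))) f)) := by
  -- notation
  set eC := inlLex (n ⊕ₗ n) (m ⊕ₗ m) with heC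
  set eF := inrLex (n ⊕ₗ n) (m ⊕ₗ m) with heF
  set F := fluctuationOp a Q Qb D with hFdef
  set sF : Finset (BlockRGIdx n m) := Finset.univ.map eF.toEmbedding with hsF
  set ΦF := ExteriorAlgebra.map (Function.ExtendByZero.linearMap R eF) with hΦF
  set ΦC := ExteriorAlgebra.map (Function.ExtendByZero.linearMap R eC) with hΦC
  set N := fluctShift R (fluctShiftMat R a Q Qb D) (fluctShiftBarMat R a Q Qb D) with hN
  have hshift : IsSpectatorShift R sF (-N) := isSpectatorShift_neg_fluctShift R _ _
  -- centrality ∕ nilpotency of embedded quadratic forms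
  have hcF : ∀ (B : Matrix m m R) (z), Commute (ΦF (quadratic R B)) z := fun B z =>
    commute_map_quadratic R ΦF B (fun x y z => by
      rw [hΦF, gen, gen, ExteriorAlgebra.map_apply_ι, ExteriorAlgebra.map_apply_ι]
      exact commute_ι_mul_ι _ _ z) z
  have hcC : ∀ (B : Matrix n n R) (z), Commute (ΦC (quadratic R B)) z := fun B z =>
    commute_map_quadratic R ΦC B (fun x y z => by
      rw [hΦC, gen, gen, ExteriorAlgebra.map_apply_ι, ExteriorAlgebra.map_apply_ι]
      exact commute_ι_mul_ι _ _ z) z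
  have hnF : ∀ B : Matrix m m R, IsNilpotent (ΦF (quadratic R B)) := fun B =>
    (isNilpotent_quadratic R B).map _
  have hnC : ∀ B : Matrix n n R, IsNilpotent (ΦC (quadratic R B)) := fun B =>
    (isNilpotent_quadratic R B).map _
  have hcM : ∀ z, Commute (ExteriorAlgebra.map (1 + -N) (ΦF (quadratic R (-F)))) z := fun z =>
    commute_map_quadratic R ((ExteriorAlgebra.map (1 + -N)).comp ΦF) (-F) (fun x y z => by
      rw [AlgHom.comp_apply, AlgHom.comp_apply, hΦF, gen, gen, ExteriorAlgebra.map_apply_ι,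
        ExteriorAlgebra.map_apply_ι, ExteriorAlgebra.map_apply_ι, ExteriorAlgebra.map_apply_ι]
      exact commute_ι_mul_ι _ _ z) z
  have hnM : IsNilpotent (ExteriorAlgebra.map (1 + -N) (ΦF (quadratic R (-F)))) := (hnF _).map _
  -- nilpotency of the block-spin exponent
  have hnE : IsNilpotent (blockRGExponent R a Q Qb) := by
    have h1 : ∀ y, chiBar (R := R) (m := m) y - ∑ x, Qb x y • psiBarF x =
        ι R ((Pi.single (eC (toLex (Sum.inl y))) 1 : BlockRGIdx n m → R) -
          ∑ x, Qb x y • (Pi.single (eF (toLex (Sum.inl x))) 1 : BlockRGIdx n m → R)) := fun y => by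
      simp only [map_sub, map_sum, map_smul, chiBar, psiBarF, gen, heC, heF]
    have h2 : ∀ y, chi (R := R) (m := m) y - ∑ x, Q y x • psiF x =
        ι R ((Pi.single (eC (toLex (Sum.inr y))) 1 : BlockRGIdx n m → R) -
          ∑ x, Q y x • (Pi.single (eF (toLex (Sum.inr x))) 1 : BlockRGIdx n m → R)) := fun y => by
      simp only [map_sub, map_sum, map_smul, chi, psiF, gen, heC, heF]
    rw [blockRGExponent]
    simp only [h1, h2]
    refine IsNilpotent.neg (IsNilpotent.smul (Commute.isNilpotent_sum (fun y _ => ⟨2, ?_⟩)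
      fun y y' _ _ => commute_ι_mul_ι _ _ _) a)
    rw [pow_two]; exact ι_mul_ι_mul_self _ _
  -- the block Gaussian is a central spectator of the fine block
  have hsC : ∀ k, eC k ∉ sF := by
    intro k hk
    obtain ⟨j, -, hj⟩ := Finset.mem_map.1 hk
    exact inlLex_ne_inrLex (m := m) (n := n) k j hj.symm
  set GC := ΦC (grassmannExp (quadratic R (-blockDirac a Q Qb D))) with hGCdef
  set GF := ΦF (grassmannExp (quadratic R (-F))) with hGFdef
  have hGCspec : GC ∈ spectatorSubalgebra R sF := map_extendByZero_mem_spectatorSubalgebra R eC hsC _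
  have hGCexp : GC = IsNilpotent.exp (ΦC (quadratic R (-blockDirac a Q Qb D))) := by
    rw [hGCdef, grassmannExp, IsNilpotent.map_exp (isNilpotent_quadratic R _)]
  have hcGC : ∀ z, Commute GC z := by
    rw [hGCexp]; exact commute_exp_of_forall_commute (hcC _) (hnC _)
  -- Step 1: completing the square in the exponent
  have hE : blockRGExponent R a Q Qb + ΦF (quadratic R (-D)) =
      ExteriorAlgebra.map (1 + -N) (ΦF (quadratic R (-F))) +
        ΦC (quadratic R (-blockDirac a Q Qb D)) := by
    rw [hΦF, hΦC, hN, hFdef, heF, heC]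
    exact blockRGExponent_add_quadratic_eq_shifted R a Q Qb D hF
  have hW : blockRGWeight R a Q Qb * ΦF (grassmannExp (quadratic R (-D))) =
      ExteriorAlgebra.map (1 + -N) GF * GC := by
    rw [blockRGWeight, hGFdef, hGCexp, grassmannExp, grassmannExp, grassmannExp,
      IsNilpotent.map_exp (isNilpotent_quadratic R _) ΦF,
      IsNilpotent.map_exp (isNilpotent_quadratic R _) ΦF, IsNilpotent.map_exp (hnF _),
      ← IsNilpotent.exp_add_of_commute (hcF _ _).symm hnE (hnF _), hE,
      IsNilpotent.exp_add_of_commute (hcM _) hnM (hnC _)]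
  -- Step 2: `f = (1-N)_* (1+N)_* f` and the block Gaussian is fixed by the shift
  have hf : ΦF f = ExteriorAlgebra.map (1 + -N) (ExteriorAlgebra.map (1 + N) (ΦF f)) := by
    rw [← AlgHom.comp_apply, ExteriorAlgebra.map_comp_map, ← Module.End.mul_eq_comp, hN,
      one_sub_mul_one_add_fluctShift, Module.End.one_eq_id, ExteriorAlgebra.map_id, AlgHom.id_apply]
  have hCfix : ExteriorAlgebra.map (1 + -N) GC = GC := hshift.map_eq_self_of_mem R hGCspec
  have hR : ExteriorAlgebra.map (1 + -N) (GC * (GF * ExteriorAlgebra.map (1 + N) (ΦF f))) =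
      GC * (ExteriorAlgebra.map (1 + -N) GF * ΦF f) := by
    rw [map_mul, map_mul, hCfix, ← hf]
  have hL : blockRGWeight R a Q Qb * ΦF (grassmannExp (quadratic R (-D)) * f) =
      ExteriorAlgebra.map (1 + -N) GF * GC * ΦF f := by
    rw [map_mul, ← mul_assoc, hW]
  have hint : blockRGWeight R a Q Qb * ΦF (grassmannExp (quadratic R (-D)) * f) =
      ExteriorAlgebra.map (1 + -N) (GC * (GF * ExteriorAlgebra.map (1 + N) (ΦF f))) := by
    rw [hL, hR, ← mul_assoc GC, (hcGC _).eq]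
  -- Step 3: translation invariance and extraction of the block Gaussian
  rw [hint, hshift.berezinOn_map R, berezinOn_mul_of_mem_spectatorSubalgebra R hGCspec]

/-! ### §4 In the tree's two-algebra framework (`fermionBlockRG`) -/

/-- **The (unnormalised) fluctuation integral** `f ↦ ∫dψ̄dψ e^{−ψ̄Fψ} f(ψ̄ + χ̄H̄, ψ + Hχ)` of Dimock (38)
— printed `Z_k(A) ∫ f(ψ + H_k(A)Ψ_k) dμ_{S_k(A)}(ψ)` up to `M⁻¹_{k,b_k}`, with *"`∫[…]dμ_{S_k(A)}(ψ)` the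
fermion Gaussian integral with covariance `S_k(A)`"* (p.8 L45) and `Z_k(A)` of (41) — as an `R`-linear
map from the fine-fermion algebra to the block-fermion algebra, in the architecture of the tree's
`fermionBlockRG`: embed `f` into the joint algebra, substitute `Λ(1 + N)`, multiply by the fine
Gaussian `e^{−ψ̄Fψ}`, integrate out the fine block, restrict along `inlLex`. [cite: Dimock2004QED3TorusII, §1.3.2 (38) p.8] -/
def fluctuationIntegral (a : R) (Q : Matrix n m R) (Qb : Matrix m n R) (D : Matrix m m R) :
    GrassmannAlgebra R (m ⊕ₗ m) →ₗ[R] GrassmannAlgebra R (n ⊕ₗ n) :=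
  (ExteriorAlgebra.map (LinearMap.funLeft R R (inlLex (n ⊕ₗ n) (m ⊕ₗ m)))).toLinearMap ∘ₗ
    berezinOn R (Finset.univ.map (inrLex (n ⊕ₗ n) (m ⊕ₗ m)).toEmbedding) ∘ₗ
      LinearMap.mulLeft R
          (ExteriorAlgebra.map (Function.ExtendByZero.linearMap R (inrLex (n ⊕ₗ n) (m ⊕ₗ m)))
            (grassmannExp (quadratic R (-fluctuationOp a Q Qb D)))) ∘ₗ
        (ExteriorAlgebra.map
            (1 + fluctShift R (fluctShiftMat R a Q Qb D) (fluctShiftBarMat R a Q Qb D))).toLinearMap ∘ₗ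
          (ExteriorAlgebra.map
            (Function.ExtendByZero.linearMap R (inrLex (n ⊕ₗ n) (m ⊕ₗ m)))).toLinearMap

/-- Unfolding `fluctuationIntegral`. [cite: Dimock2004QED3TorusII, §1.3.2 (38) p.8] -/
theorem fluctuationIntegral_apply (a : R) (Q : Matrix n m R) (Qb : Matrix m n R) (D : Matrix m m R)
    (f : GrassmannAlgebra R (m ⊕ₗ m)) :
    fluctuationIntegral R a Q Qb D f =
      ExteriorAlgebra.map (LinearMap.funLeft R R (inlLex (n ⊕ₗ n) (m ⊕ₗ m)))
        (berezinOn R (Finset.univ.map (inrLex (n ⊕ₗ n) (m ⊕ₗ m)).toEmbedding)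
          (ExteriorAlgebra.map (Function.ExtendByZero.linearMap R (inrLex (n ⊕ₗ n) (m ⊕ₗ m)))
              (grassmannExp (quadratic R (-fluctuationOp a Q Qb D))) *
            ExteriorAlgebra.map (1 + fluctShift R (fluctShiftMat R a Q Qb D) (fluctShiftBarMat R a Q Qb D))
              (ExteriorAlgebra.map
                (Function.ExtendByZero.linearMap R (inrLex (n ⊕ₗ n) (m ⊕ₗ m))) f))) :=
  rfl

/-- **Dimock (38) for the tree's block-spin transformation**: for every density `f` of the fine
fermions, `T_{a,Q}(e^{−ψ̄Dψ} f) = e^{−χ̄D₁χ} · ∫dψ̄dψ e^{−ψ̄Fψ} f(ψ̄ + χ̄H̄, ψ + Hχ)` (`F = D + aQ̄Q` with unit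
determinant, `D₁ = a − a²QF⁻¹Q̄`, `H = aF⁻¹Q̄`, `H̄ = aQF⁻¹`); the case `f = 1` is the tree's
`fermionBlockRG_grassmannExp_quadratic` (see `fluctuationIntegral_one`). [cite: Dimock2004QED3TorusII, §1.3.2 (38) p.8] -/
theorem fermionBlockRG_grassmannExp_quadratic_mul (a : R) (Q : Matrix n m R) (Qb : Matrix m n R)
    (D : Matrix m m R) (hF : IsUnit (fluctuationOp a Q Qb D).det) (f : GrassmannAlgebra R (m ⊕ₗ m)) :
    fermionBlockRG R a Q Qb (grassmannExp (quadratic R (-D)) * f) =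
      grassmannExp (quadratic R (-blockDirac a Q Qb D)) * fluctuationIntegral R a Q Qb D f := by
  rw [fermionBlockRG_apply, berezinOn_blockRGWeight_mul_gaussian_mul R a Q Qb D hF f, map_mul,
    map_funLeft_map_extendByZero_inlLex, fluctuationIntegral_apply]

/-- **Dimock (41), `Z_k(A) = M⁻¹_{k,b_k} ∫ e^{−(ψ̄, D#_k(A)ψ)}`**: the fluctuation integral of `f = 1` is
the fine Gaussian integral `∫dψ̄dψ e^{−ψ̄Fψ} = ε det(−F)` (BOS p.237 L16 *"`∫dφ̄dφ e^{(φ̄,Aφ)} = det A`"*;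
`ε = (−1)^{|m|(|m|−1)/2}` is the orientation sign of the tree's Berezin integral,
`berezin_grassmannExp_quadratic`). [cite: Dimock2004QED3TorusII, §1.3.2 (41) p.8] -/
theorem fluctuationIntegral_one (a : R) (Q : Matrix n m R) (Qb : Matrix m n R) (D : Matrix m m R) :
    fluctuationIntegral R a Q Qb D 1 =
      ((-1 : R) ^ (Fintype.card m * (Fintype.card m - 1) / 2) * (-fluctuationOp a Q Qb D).det) •
        (1 : GrassmannAlgebra R (n ⊕ₗ n)) := by
  rw [fluctuationIntegral_apply, map_one, map_one, mul_one, berezinOn_map_map_extendByZero,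
    berezinOn_univ_holds R, berezin_grassmannExp_quadratic_holds R, AlgHom.commutes, AlgHom.commutes,
    Algebra.algebraMap_eq_smul_one]

/-- Consistency with the tree's closed form for `f = 1` (`fermionBlockRG_grassmannExp_quadratic`,
BOS Lemma II.2): re-derived from Dimock (38) and (41). -/
example (a : R) (Q : Matrix n m R) (Qb : Matrix m n R) (D : Matrix m m R)
    (hF : IsUnit (fluctuationOp a Q Qb D).det) :
    fermionBlockRG R a Q Qb (grassmannExp (quadratic R (-D))) =
      ((-1 : R) ^ (Fintype.card m * (Fintype.card m - 1) / 2) * (-fluctuationOp a Q Qb D).det) •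
        grassmannExp (quadratic R (-blockDirac a Q Qb D)) := by
  rw [← mul_one (grassmannExp (quadratic R (-D))), fermionBlockRG_grassmannExp_quadratic_mul R a Q Qb D hF,
    fluctuationIntegral_one, mul_smul_comm, mul_one]


/-! ### §5 Dimock (43)–(44): the generating function (sources), in an ambient algebra -/

section Sources

variable {J : Type*} [LinearOrder J] [Fintype J]

omit [Fintype J] [LinearOrder m] [LinearOrder J] [LinearOrder n] [Algebra ℚ R] in
/-- Cross term `Σ_{xx'} C_{xx'} J̄_x η_{x'} = Σ_{y x'} (cQC)_{y x'} Φ̄_y η_{x'}` (the source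
`(H_kΨ̄_k, η)` of (44)). [cite: Dimock2004QED3TorusII, §1.3.3 (44) p.8] -/
theorem sum_smul_ι_srcBarVec_mul_ι (c : R) (Q : Matrix n m R) (ab : n → J → R) (v : m → J → R)
    (C : Matrix m m R) :
    ∑ x, ∑ x', C x x' • (ι R (srcBarVec R c Q ab x) * ι R (v x')) =
      ∑ y, ∑ x', (c • (Q * C)) y x' • (ι R (ab y) * ι R (v x')) := by
  simp only [ι_srcBarVec, Finset.sum_mul, smul_mul_assoc, Finset.smul_sum, smul_smul]
  simp only [Matrix.smul_apply, Matrix.mul_apply, smul_eq_mul, Finset.mul_sum, Finset.sum_smul]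
  calc ∑ x, ∑ x', ∑ y, (C x x' * (c * Q y x)) • (ι R (ab y) * ι R (v x'))
      = ∑ x, ∑ y, ∑ x', (C x x' * (c * Q y x)) • (ι R (ab y) * ι R (v x')) :=
        Finset.sum_congr rfl fun _ _ => Finset.sum_comm
    _ = ∑ y, ∑ x, ∑ x', (C x x' * (c * Q y x)) • (ι R (ab y) * ι R (v x')) := Finset.sum_comm
    _ = ∑ y, ∑ x', ∑ x, (C x x' * (c * Q y x)) • (ι R (ab y) * ι R (v x')) :=
        Finset.sum_congr rfl fun _ _ => Finset.sum_comm
    _ = _ := by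
        refine Finset.sum_congr rfl fun y _ => Finset.sum_congr rfl fun x' _ =>
          Finset.sum_congr rfl fun x _ => ?_
        ring_nf

omit [Fintype J] [LinearOrder m] [LinearOrder J] [LinearOrder n] [Algebra ℚ R] in
/-- Cross term `Σ_{xx'} C_{xx'} η̄_x J_{x'} = Σ_{x y} (cCQ̄)_{x y} η̄_x Φ_y` (the source `(η̄, H_kΨ_k)`
of (44)). [cite: Dimock2004QED3TorusII, §1.3.3 (44) p.8] -/
theorem sum_smul_ι_mul_ι_srcVec (c : R) (Qb : Matrix m n R) (a : n → J → R) (vbar : m → J → R)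
    (C : Matrix m m R) :
    ∑ x, ∑ x', C x x' • (ι R (vbar x) * ι R (srcVec R c Qb a x')) =
      ∑ x, ∑ y, (c • (C * Qb)) x y • (ι R (vbar x) * ι R (a y)) := by
  simp only [ι_srcVec, Finset.mul_sum, mul_smul_comm, Finset.smul_sum, smul_smul]
  simp only [Matrix.smul_apply, Matrix.mul_apply, smul_eq_mul, Finset.mul_sum, Finset.sum_smul]
  refine Finset.sum_congr rfl fun x _ => ?_
  rw [Finset.sum_comm]
  refine Finset.sum_congr rfl fun y _ => Finset.sum_congr rfl fun x' _ => ?_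
  ring_nf

omit [Fintype m] [Fintype J] [LinearOrder n] [Algebra ℚ R] in
/-- The total source `J̄ + η̄` is a spectator. [folklore] -/
private theorem srcBarVec_add_apply (c : R) (Q : Matrix n m R) {ab : n → J → R} {vbar : m → J → R}
    (e : m ⊕ₗ m ↪o J) (hab : ∀ y k, ab y (e k) = 0) (hvbar : ∀ i k, vbar i (e k) = 0) (j : m)
    (k : m ⊕ₗ m) : (srcBarVec R c Q ab j + vbar j) (e k) = 0 := by
  simp only [Pi.add_apply, srcBarVec, Finset.sum_apply, Pi.smul_apply, hab, smul_zero,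
    Finset.sum_const_zero, hvbar, add_zero]

omit [Fintype m] [Fintype J] [LinearOrder n] [Algebra ℚ R] in
/-- The total source `J + η` is a spectator. [folklore] -/
private theorem srcVec_add_apply (c : R) (Qb : Matrix m n R) {a : n → J → R} {v : m → J → R}
    (e : m ⊕ₗ m ↪o J) (ha : ∀ y k, a y (e k) = 0) (hv : ∀ i k, v i (e k) = 0) (i : m)
    (k : m ⊕ₗ m) : (srcVec R c Qb a i + v i) (e k) = 0 := by
  simp only [Pi.add_apply, srcVec, Finset.sum_apply, Pi.smul_apply, ha, smul_zero,
    Finset.sum_const_zero, hv, add_zero]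

omit [Fintype J] [Fintype m] [LinearOrder m] [LinearOrder J] [Algebra ℚ R] in
/-- The spectator term `cΦ̄Φ` as the quadratic form of `c·1`. [folklore] -/
private theorem smul_sum_ι_mul_ι_eq (c : R) (ab a : n → J → R) :
    c • ∑ y, ι R (ab y) * ι R (a y) =
      ∑ y, ∑ y', (c • (1 : Matrix n n R)) y y' • (ι R (ab y) * ι R (a y')) := by
  simp only [Matrix.smul_apply, Matrix.one_apply, smul_eq_mul, mul_ite, mul_one, mul_zero, ite_smul,
    zero_smul, Finset.smul_sum]
  refine Finset.sum_congr rfl fun y _ => ?_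
  rw [Finset.sum_ite_eq, if_pos (Finset.mem_univ y)]

/-- **Dimock (43)–(44): the generating function, in an ambient algebra.**  In `Λ(J)` with the fine
fermions `Ψ̄ = psiBarOf e`, `Ψ = psiOf e` placed by an order embedding `e`, a block field `Φ̄_y = ι(ab y)`,
`Φ_y = ι(a y)` and sources `η̄_i = ι(vbar i)`, `η_j = ι(v j)` — arbitrary degree-one spectators
(vanishing on the range of `e`) — and a fine action `D` whose fluctuation operator `F = D + cQ̄Q` has
unit determinant:
`∫dθ_s e^{−cΣ_y(Φ̄_y − (Ψ̄Q̄)_y)(Φ_y − (QΨ)_y)} e^{−Ψ̄DΨ + Σ_i(η̄_iΨ_i + Ψ̄_iη_i)}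
   = ε det(−F) · exp(−Σ_{yy'}(D₁)_{yy'}Φ̄_yΦ_{y'} + Σ_{iy} H_{iy} η̄_iΦ_y + Σ_{yi} H̄_{yi} Φ̄_yη_i
                      + Σ_{ij} (F⁻¹)_{ij} η̄_iη_j)`
— printed (44): `Ω_k(A, Ψ_k, η) = Z_k(A) exp(−(Ψ̄_k, D_k(A)Ψ_k) + (η̄, H_k(A)Ψ_k) + (H_k(A)Ψ̄_k, η) + (η̄, S_k(A)η))`
with `Z_k ↦ ε det(−F)` (no `M⁻¹_{k,b_k}`), `D_k = blockDirac`, `H_k = (fluctShiftMat, fluctShiftBarMat)`,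
`S_k = F⁻¹`.  Proof as printed (*"Using (38) and `∫ exp((η̄,ψ) + (ψ̄,η))dμ_S(ψ) = exp((η̄, Sη))`"*):
expand the exponent into the fine Gaussian `−Ψ̄FΨ` plus the total sources `J̄ + η̄`, `J + η`
(`blockExponent_add_quadratic_eq`), integrate with the tree's Gaussian-with-sources formula
`berezinOn_grassmannExp_quadratic_add_sources`, and recombine `(J̄ + η̄)F⁻¹(J + η) − cΦ̄Φ`.
[cite: Dimock2004QED3TorusII, §1.3.3 (43)–(44) p.8] -/
theorem berezinOn_blockWeight_mul_grassmannExp_quadratic_add_sources (e : m ⊕ₗ m ↪o J) (c : R)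
    (Q : Matrix n m R) (Qb : Matrix m n R) (D : Matrix m m R)
    (hF : IsUnit (fluctuationOp c Q Qb D).det)
    (ab a : n → J → R) (hab : ∀ y k, ab y (e k) = 0) (ha : ∀ y k, a y (e k) = 0)
    (vbar v : m → J → R) (hvbar : ∀ i k, vbar i (e k) = 0) (hv : ∀ i k, v i (e k) = 0) :
    berezinOn R (Finset.univ.map e.toEmbedding)
        (grassmannExp (-(c • ∑ y, (ι R (ab y) - ∑ i, Qb i y • psiBarOf R e i) *
            (ι R (a y) - ∑ j, Q y j • psiOf R e j))) *
          grassmannExp (ExteriorAlgebra.map (Function.ExtendByZero.linearMap R e) (quadratic R (-D)) +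
            ∑ i, (ι R (vbar i) * psiOf R e i + psiBarOf R e i * ι R (v i)))) =
      ((-1 : R) ^ (Fintype.card m * (Fintype.card m - 1) / 2) * (-fluctuationOp c Q Qb D).det) •
        grassmannExp (-(∑ y, ∑ y', blockDirac c Q Qb D y y' • (ι R (ab y) * ι R (a y'))) +
          ∑ i, ∑ y, fluctShiftMat R c Q Qb D i y • (ι R (vbar i) * ι R (a y)) +
          ∑ y, ∑ i, fluctShiftBarMat R c Q Qb D y i • (ι R (ab y) * ι R (v i)) +
          ∑ i, ∑ j, (fluctuationOp c Q Qb D)⁻¹ i j • (ι R (vbar i) * ι R (v j))) := by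
  -- notation
  set F := fluctuationOp c Q Qb D with hFdef
  set s : Finset J := Finset.univ.map e.toEmbedding with hs
  set Φ := ExteriorAlgebra.map (Function.ExtendByZero.linearMap R e) with hΦ
  set S₀ : GrassmannAlgebra R J :=
    ∑ x, (ι R (srcBarVec R c Q ab x) * psiOf R e x + psiBarOf R e x * ι R (srcVec R c Qb a x)) with hS₀
  set Sv : GrassmannAlgebra R J := ∑ i, (ι R (vbar i) * psiOf R e i + psiBarOf R e i * ι R (v i))
    with hSv
  set S : GrassmannAlgebra R J :=
    ∑ x, (ι R (srcBarVec R c Q ab x + vbar x) * psiOf R e x +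
      psiBarOf R e x * ι R (srcVec R c Qb a x + v x)) with hS
  set Cq : GrassmannAlgebra R J := -(c • ∑ y, ι R (ab y) * ι R (a y)) with hCq
  set W : GrassmannAlgebra R J :=
    -(c • ∑ y, (ι R (ab y) - ∑ i, Qb i y • psiBarOf R e i) * (ι R (a y) - ∑ j, Q y j • psiOf R e j))
    with hW
  -- units and inverses of `A = -F`
  have hAunit : IsUnit (-F).det := by
    rw [Matrix.det_neg]; exact ((isUnit_one.neg).pow _).mul hF
  have hAinv : (-F)⁻¹ = -F⁻¹ := by
    refine Matrix.inv_eq_left_inv ?_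
    rw [neg_mul_neg, Matrix.nonsing_inv_mul _ hF]
  -- centrality ∕ nilpotency
  have hcΦ : ∀ (B : Matrix m m R) (z), Commute (Φ (quadratic R B)) z := fun B z =>
    commute_map_quadratic R Φ B (fun x y z => by
      rw [hΦ, gen, gen, ExteriorAlgebra.map_apply_ι, ExteriorAlgebra.map_apply_ι]
      exact commute_ι_mul_ι _ _ z) z
  have hnΦ : ∀ B : Matrix m m R, IsNilpotent (Φ (quadratic R B)) := fun B =>
    (isNilpotent_quadratic R B).map _
  have hnsrc : ∀ (ub u : m → J → R), IsNilpotent (∑ x, (ι R (ub x) * psiOf R e x +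
      psiBarOf R e x * ι R (u x))) := fun ub u => by
    refine Commute.isNilpotent_sum (fun i _ => ?_) fun i j _ _ => ?_
    · refine Commute.isNilpotent_add ?_ ⟨2, ?_⟩ ⟨2, ?_⟩
      · exact commute_ι_mul_ι _ _ _
      · rw [pow_two]; exact ι_mul_ι_mul_self _ _
      · rw [pow_two]; exact ι_mul_ι_mul_self _ _
    · exact Commute.add_left (commute_ι_mul_ι _ _ _) (commute_ι_mul_ι _ _ _)
  have hnS : IsNilpotent S := hnsrc _ _
  have hnSv : IsNilpotent Sv := hnsrc _ _
  have hcC : ∀ z, Commute Cq z := fun z => by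
    rw [hCq]; exact Commute.neg_left (Commute.smul_left (Commute.sum_left _ _ _ fun y _ =>
      commute_ι_mul_ι _ _ z) c)
  have hnC : IsNilpotent Cq := by
    rw [hCq]
    refine IsNilpotent.neg (IsNilpotent.smul (Commute.isNilpotent_sum (fun y _ => ⟨2, ?_⟩)
      fun y y' _ _ => commute_ι_mul_ι _ _ _) c)
    rw [pow_two]; exact ι_mul_ι_mul_self _ _
  have hcW : ∀ z, Commute W z := fun z => by
    rw [hW]; exact commute_blockExponent R e c Q Qb ab a z
  have hnW : IsNilpotent W := by rw [hW]; exact isNilpotent_blockExponent R e c Q Qb ab a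
  have hWeq : W + Φ (quadratic R (-D)) = Φ (quadratic R (-F)) + S₀ + Cq := by
    rw [hW, hΦ, hFdef, hS₀, hCq]
    exact blockExponent_add_quadratic_eq R e c Q Qb D ab a
  have hSS : S₀ + Sv = S := by
    rw [hS₀, hSv, hS, ← Finset.sum_add_distrib]
    refine Finset.sum_congr rfl fun x _ => ?_
    rw [map_add, map_add, add_mul, mul_add]
    abel
  have hY : IsNilpotent (Φ (quadratic R (-F)) + S) := Commute.isNilpotent_add (hcΦ _ _) (hnΦ _) hnS
  have hY' : IsNilpotent (Φ (quadratic R (-D)) + Sv) :=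
    Commute.isNilpotent_add (hcΦ _ _) (hnΦ _) hnSv
  -- Step 1: the integrand is `exp (Φ(quadratic(-F)) + S) * exp Cq`
  have h1 : grassmannExp W * grassmannExp (Φ (quadratic R (-D)) + Sv) =
      grassmannExp (Φ (quadratic R (-F)) + S) * grassmannExp Cq := by
    rw [grassmannExp, grassmannExp, grassmannExp, grassmannExp,
      ← IsNilpotent.exp_add_of_commute (hcW _) hnW hY',
      ← IsNilpotent.exp_add_of_commute ((hcC _).symm) hY hnC]
    congr 1
    rw [← add_assoc, hWeq, ← hSS]; abel
  -- Step 2: Gaussian integral with sources over the integrated variables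
  have h2 : berezinOn R s (grassmannExp (Φ (quadratic R (-F)) + S)) =
      ((-1 : R) ^ (Fintype.card m * (Fintype.card m - 1) / 2) * (-F).det) •
        grassmannExp (-∑ x, ∑ x', (-F)⁻¹ x x' •
          (ι R (srcBarVec R c Q ab x + vbar x) * ι R (srcVec R c Qb a x' + v x'))) :=
    berezinOn_grassmannExp_quadratic_add_sources R e (-F) hAunit
      (fun x => srcBarVec R c Q ab x + vbar x) (fun x => srcVec R c Qb a x + v x)
      (fun x k => srcBarVec_add_apply R c Q e hab hvbar x k)
      (fun x k => srcVec_add_apply R c Qb e ha hv x k)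
  -- Step 3: the spectator `exp Cq` factors out of the integral
  have hCmem : grassmannExp Cq ∈ spectatorSubalgebra R s := by
    refine exp_mem_of_mem ?_ hnC
    rw [hCq]
    refine Subalgebra.neg_mem _ (Subalgebra.smul_mem _ (Subalgebra.sum_mem _ fun y _ =>
      Subalgebra.mul_mem _ (ι_mem_spectatorSubalgebra R fun i hi => ?_)
        (ι_mem_spectatorSubalgebra R fun i hi => ?_)) _)
    · obtain ⟨k, -, rfl⟩ := Finset.mem_map.1 hi; exact hab y k
    · obtain ⟨k, -, rfl⟩ := Finset.mem_map.1 hi; exact ha y k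
  have hCcomm : ∀ z, Commute (grassmannExp Cq) z := commute_exp_of_forall_commute hcC hnC
  -- Step 4: recombination of the exponent
  have h4 : -∑ x, ∑ x', (-F)⁻¹ x x' •
        (ι R (srcBarVec R c Q ab x + vbar x) * ι R (srcVec R c Qb a x' + v x')) + Cq =
      -(∑ y, ∑ y', blockDirac c Q Qb D y y' • (ι R (ab y) * ι R (a y'))) +
          ∑ i, ∑ y, fluctShiftMat R c Q Qb D i y • (ι R (vbar i) * ι R (a y)) +
          ∑ y, ∑ i, fluctShiftBarMat R c Q Qb D y i • (ι R (ab y) * ι R (v i)) +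
          ∑ i, ∑ j, F⁻¹ i j • (ι R (vbar i) * ι R (v j)) := by
    have hx : ∀ x x', (-F)⁻¹ x x' •
        (ι R (srcBarVec R c Q ab x + vbar x) * ι R (srcVec R c Qb a x' + v x')) =
        -(F⁻¹ x x' • (ι R (srcBarVec R c Q ab x) * ι R (srcVec R c Qb a x'))) +
        -(F⁻¹ x x' • (ι R (srcBarVec R c Q ab x) * ι R (v x'))) +
        -(F⁻¹ x x' • (ι R (vbar x) * ι R (srcVec R c Qb a x'))) +
        -(F⁻¹ x x' • (ι R (vbar x) * ι R (v x'))) := fun x x' => by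
      rw [hAinv, Matrix.neg_apply, map_add, map_add, add_mul, mul_add, mul_add]
      simp only [neg_smul, smul_add]
      abel
    simp only [hx, Finset.sum_add_distrib, Finset.sum_neg_distrib, neg_add, neg_neg]
    rw [sum_smul_ι_srcBarVec_mul_ι_srcVec, sum_smul_ι_srcBarVec_mul_ι, sum_smul_ι_mul_ι_srcVec,
      fluctShiftMat, fluctShiftBarMat, ← hFdef, hCq, smul_sum_ι_mul_ι_eq]
    have hD : ∑ y, ∑ y', (c ^ 2 • (Q * F⁻¹ * Qb)) y y' • (ι R (ab y) * ι R (a y')) +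
        -(∑ y, ∑ y', (c • (1 : Matrix n n R)) y y' • (ι R (ab y) * ι R (a y'))) =
        -(∑ y, ∑ y', blockDirac c Q Qb D y y' • (ι R (ab y) * ι R (a y'))) := by
      rw [← Finset.sum_neg_distrib, ← Finset.sum_neg_distrib, ← Finset.sum_add_distrib]
      refine Finset.sum_congr rfl fun y _ => ?_
      rw [← Finset.sum_neg_distrib, ← Finset.sum_neg_distrib, ← Finset.sum_add_distrib]
      refine Finset.sum_congr rfl fun y' _ => ?_
      rw [← neg_smul, ← add_smul, ← neg_smul]
      congr 1
      simp only [blockDirac, ← hFdef, Matrix.sub_apply, Matrix.smul_apply, smul_eq_mul]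
      ring
    rw [← hD]
    abel
  have hT : IsNilpotent (-∑ x, ∑ x', (-F)⁻¹ x x' •
      (ι R (srcBarVec R c Q ab x + vbar x) * ι R (srcVec R c Qb a x' + v x'))) :=
    (isNilpotent_sum_sum_smul_ι_mul_ι _ _ _).neg
  have hTc : ∀ z, Commute (-∑ x, ∑ x', (-F)⁻¹ x x' •
      (ι R (srcBarVec R c Q ab x + vbar x) * ι R (srcVec R c Qb a x' + v x'))) z := fun z =>
    (commute_sum_sum_smul_ι_mul_ι _ _ _ z).neg_left
  -- assemble
  rw [h1, berezinOn_mul_of_mem_spectatorSubalgebra_of_commute R hCmem hCcomm, h2, smul_mul_assoc,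
    grassmannExp, grassmannExp, ← IsNilpotent.exp_add_of_commute (hTc _) hT hnC, h4, grassmannExp]

end Sources

/-! ### §6 The block two-point function: the `η̄_iη_j`-coefficient of (44) -/

section TwoPoint

omit [LinearOrder n] [Fintype n] in
/-- Odd moments of a fermionic Gaussian vanish: `∫ e^{ψ̄Aψ} ψ̄_i = 0` (the tree's charge rule).
[folklore] -/
private theorem berezin_grassmannExp_quadratic_mul_psiBar_eq_zero (A : Matrix m m R) (i : m) :
    berezin R (m ⊕ₗ m) (grassmannExp (quadratic R A) * psiBar R i) = 0 := by
  have h := berezin_grassmannExp_quadratic_mul_prod_eq_zero_of_ne R A (k := 1) (l := 0) one_ne_zero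
    (fun _ => i) (fun b => b.elim0)
  simpa [List.ofFn_succ, List.ofFn_zero] using h

omit [LinearOrder n] [Fintype n] in
/-- Odd moments of a fermionic Gaussian vanish: `∫ e^{ψ̄Aψ} ψ_j = 0`. [folklore] -/
private theorem berezin_grassmannExp_quadratic_mul_psi_eq_zero (A : Matrix m m R) (j : m) :
    berezin R (m ⊕ₗ m) (grassmannExp (quadratic R A) * psi R j) = 0 := by
  have h := berezin_grassmannExp_quadratic_mul_prod_eq_zero_of_ne R A (k := 0) (l := 1) zero_ne_one
    (fun a => a.elim0) (fun _ => j)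
  simpa [List.ofFn_succ, List.ofFn_zero] using h

omit [Algebra ℚ R] in
/-- Integrating an embedded fine-algebra element over the fine block gives its Berezin integral
(transport `berezinOn_map_map_extendByZero` + `berezinOn_univ`). [folklore] -/
private theorem berezinOn_map_inrLex (x : GrassmannAlgebra R (m ⊕ₗ m)) :
    berezinOn R (Finset.univ.map (inrLex (n ⊕ₗ n) (m ⊕ₗ m)).toEmbedding)
        (ExteriorAlgebra.map (Function.ExtendByZero.linearMap R (inrLex (n ⊕ₗ n) (m ⊕ₗ m))) x) =
      algebraMap R _ (berezin R (m ⊕ₗ m) x) := by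
  rw [berezinOn_map_map_extendByZero, berezinOn_univ_holds R, AlgHom.commutes]

/-- **The fluctuation integral of `ψ̄_iψ_j`** (the `η̄η`-quadratic part of Dimock's generating function
(44) read for the pair `ψ̄_i, ψ_j`): `∫dψ̄dψ e^{−ψ̄Fψ} (ψ̄ + χ̄H̄)_i (ψ + Hχ)_j = ε adj(−F)_{ji} · 1 + ε det(−F) · (χ̄H̄)_i (Hχ)_j`
— the odd cross terms vanish, `∫ e^{−ψ̄Fψ} ψ̄_iψ_j = ε adj(−F)_{ji}` (the tree's two-point function
`berezin_grassmannExp_quadratic_mul_psiBar_mul_psi`; `adj(−F) = det(−F)·(−F)⁻¹` when `det F` is a unit)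
and `∫ e^{−ψ̄Fψ} = ε det(−F)`. No invertibility hypothesis is needed for this evaluation.
[cite: Dimock2004QED3TorusII, §1.3.3 (44) p.8] -/
theorem fluctuationIntegral_psiBar_mul_psi (a : R) (Q : Matrix n m R) (Qb : Matrix m n R)
    (D : Matrix m m R) (i j : m) :
    fluctuationIntegral R a Q Qb D (psiBar R i * psi R j) =
      algebraMap R (GrassmannAlgebra R (n ⊕ₗ n))
          ((-1 : R) ^ (Fintype.card m * (Fintype.card m - 1) / 2) *
            (-fluctuationOp a Q Qb D).adjugate j i) +
        ((-1 : R) ^ (Fintype.card m * (Fintype.card m - 1) / 2) * (-fluctuationOp a Q Qb D).det) •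
          ((∑ y, fluctShiftBarMat R a Q Qb D y i • psiBar R y) *
            ∑ y, fluctShiftMat R a Q Qb D j y • psi R y) := by
  rw [fluctuationIntegral_apply]
  -- notation
  set eC := inlLex (n ⊕ₗ n) (m ⊕ₗ m) with heC
  set eF := inrLex (n ⊕ₗ n) (m ⊕ₗ m) with heF
  set F := fluctuationOp a Q Qb D with hFdef
  set H := fluctShiftMat R a Q Qb D with hH
  set Hb := fluctShiftBarMat R a Q Qb D with hHb
  set sF : Finset (BlockRGIdx n m) := Finset.univ.map eF.toEmbedding with hsF
  set ΦF := ExteriorAlgebra.map (Function.ExtendByZero.linearMap R eF) with hΦF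
  set ΦC := ExteriorAlgebra.map (Function.ExtendByZero.linearMap R eC) with hΦC
  set N := fluctShift R H Hb with hN
  set GF := ΦF (grassmannExp (quadratic R (-F))) with hGFdef
  set Bb : GrassmannAlgebra R (BlockRGIdx n m) := ∑ y, Hb y i • chiBar (m := m) y with hBb
  set B : GrassmannAlgebra R (BlockRGIdx n m) := ∑ y, H j y • chi (m := m) y with hB
  set ε : R := (-1 : R) ^ (Fintype.card m * (Fintype.card m - 1) / 2) with hε
  -- generators under the embeddings
  have hpb : ΦF (psiBar R i) = psiBarF i := by
    rw [hΦF, psiBar, map_extendByZero_gen']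
  have hp : ΦF (psi R j) = psiF j := by
    rw [hΦF, psi, map_extendByZero_gen']
  have hBbι : Bb = ExteriorAlgebra.ι R (fluctShiftBarVec R Hb i) := (ι_fluctShiftBarVec R Hb i).symm
  have hBι : B = ExteriorAlgebra.ι R (fluctShiftVec R H j) := (ι_fluctShiftVec R H j).symm
  have hBbC : Bb = ΦC (∑ y, Hb y i • psiBar R y) := by
    simp only [hBb, hΦC, map_sum, map_smul, psiBar, map_extendByZero_gen', heC]
  have hBC : B = ΦC (∑ y, H j y • psi R y) := by
    simp only [hB, hΦC, map_sum, map_smul, psi, map_extendByZero_gen', heC]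
  -- the shift on the two generators
  have hNpb : ExteriorAlgebra.map (1 + N) (psiBarF (n := n) i) = psiBarF i + Bb :=
    map_one_add_fluctShift_psiBarF R H Hb i
  have hNp : ExteriorAlgebra.map (1 + N) (psiF (n := n) j) = psiF j + B :=
    map_one_add_fluctShift_psiF R H Hb j
  -- spectators
  have hBb_mem : Bb ∈ spectatorSubalgebra R sF := by
    rw [hBbι]
    refine ι_mem_spectatorSubalgebra R fun x hx => ?_
    obtain ⟨k, -, rfl⟩ := Finset.mem_map.1 hx
    exact fluctShiftBarVec_apply_inrLex R Hb i k
  have hB_mem : B ∈ spectatorSubalgebra R sF := by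
    rw [hBι]
    refine ι_mem_spectatorSubalgebra R fun x hx => ?_
    obtain ⟨k, -, rfl⟩ := Finset.mem_map.1 hx
    exact fluctShiftVec_apply_inrLex R H j k
  -- the fine Gaussian is central
  have hcF : ∀ (A : Matrix m m R) (z), Commute (ΦF (quadratic R A)) z := fun A z =>
    commute_map_quadratic R ΦF A (fun x y z => by
      rw [hΦF, gen, gen, ExteriorAlgebra.map_apply_ι, ExteriorAlgebra.map_apply_ι]
      exact commute_ι_mul_ι _ _ z) z
  have hcGF : ∀ z, Commute GF z := by
    rw [hGFdef, grassmannExp, IsNilpotent.map_exp (isNilpotent_quadratic R _)]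
    exact commute_exp_of_forall_commute (hcF _) ((isNilpotent_quadratic R _).map _)
  -- the four terms
  have t1 : berezinOn R sF (GF * (psiBarF i * psiF j)) = algebraMap R _ (ε * (-F).adjugate j i) := by
    rw [hGFdef, ← hpb, ← hp, ← map_mul, ← map_mul, berezinOn_map_inrLex,
      berezin_grassmannExp_quadratic_mul_psiBar_mul_psi]
  have t2 : berezinOn R sF (GF * (psiBarF i * B)) = 0 := by
    have hanti : psiBarF (R := R) (n := n) i * B = -(B * psiBarF i) := by
      rw [hBι, psiBarF, gen]; exact ι_mul_ι_eq_neg _ _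
    rw [hanti, mul_neg, ← mul_assoc, (hcGF B).eq, mul_assoc, map_neg,
      berezinOn_mul_of_mem_spectatorSubalgebra R hB_mem, hGFdef, ← hpb, ← map_mul,
      berezinOn_map_inrLex, berezin_grassmannExp_quadratic_mul_psiBar_eq_zero, map_zero, mul_zero,
      neg_zero]
  have t3 : berezinOn R sF (GF * (Bb * psiF j)) = 0 := by
    rw [← mul_assoc, (hcGF Bb).eq, mul_assoc, berezinOn_mul_of_mem_spectatorSubalgebra R hBb_mem,
      hGFdef, ← hp, ← map_mul, berezinOn_map_inrLex, berezin_grassmannExp_quadratic_mul_psi_eq_zero,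
      map_zero, mul_zero]
  have t4 : berezinOn R sF (GF * (Bb * B)) = Bb * B * algebraMap R _ (ε * (-F).det) := by
    rw [(hcGF _).eq, berezinOn_mul_of_mem_spectatorSubalgebra R (Subalgebra.mul_mem _ hBb_mem hB_mem),
      hGFdef, berezinOn_map_inrLex, berezin_grassmannExp_quadratic_holds R]
  -- assemble
  rw [map_mul ΦF, hpb, hp, map_mul (ExteriorAlgebra.map (1 + N)), hNpb, hNp, add_mul, mul_add, mul_add,
    mul_add, mul_add, mul_add, map_add (berezinOn R sF), map_add (berezinOn R sF),
    map_add (berezinOn R sF), t1, t2, t3, t4, add_zero, zero_add,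
    map_add (ExteriorAlgebra.map (LinearMap.funLeft R R eC)),
    AlgHom.commutes, map_mul (ExteriorAlgebra.map (LinearMap.funLeft R R eC)),
    map_mul (ExteriorAlgebra.map (LinearMap.funLeft R R eC)), AlgHom.commutes, hBbC, hBC, heC,
    map_funLeft_map_extendByZero_inlLex, map_funLeft_map_extendByZero_inlLex, ← Algebra.commutes,
    ← Algebra.smul_def]

/-- **The block-spin transformation of a Gaussian two-point insertion** — the `η̄_iη_j`-coefficient of
Dimock's (43)–(44) for the tree's `fermionBlockRG` (the one-step decomposition of the fermion
two-point function, cf. Bałaban–O'Carroll–Schor Theorem II.1):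
`T_{a,Q}(e^{−ψ̄Dψ} ψ̄_iψ_j) = e^{−χ̄D₁χ} · (ε adj(−F)_{ji} · 1 + ε det(−F) · (χ̄H̄)_i (Hχ)_j)`,
`F = D + aQ̄Q` with unit determinant, `H = aF⁻¹Q̄`, `H̄ = aQF⁻¹`, `D₁ = a − a²QF⁻¹Q̄`.
[cite: Dimock2004QED3TorusII, §1.3.3 (44) p.8] -/
theorem fermionBlockRG_grassmannExp_quadratic_mul_psiBar_mul_psi (a : R) (Q : Matrix n m R)
    (Qb : Matrix m n R) (D : Matrix m m R) (hF : IsUnit (fluctuationOp a Q Qb D).det) (i j : m) :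
    fermionBlockRG R a Q Qb (grassmannExp (quadratic R (-D)) * (psiBar R i * psi R j)) =
      grassmannExp (quadratic R (-blockDirac a Q Qb D)) *
        (algebraMap R (GrassmannAlgebra R (n ⊕ₗ n))
            ((-1 : R) ^ (Fintype.card m * (Fintype.card m - 1) / 2) *
              (-fluctuationOp a Q Qb D).adjugate j i) +
          ((-1 : R) ^ (Fintype.card m * (Fintype.card m - 1) / 2) * (-fluctuationOp a Q Qb D).det) •
            ((∑ y, fluctShiftBarMat R a Q Qb D y i • psiBar R y) *
              ∑ y, fluctShiftMat R a Q Qb D j y • psi R y)) := by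
  rw [fermionBlockRG_grassmannExp_quadratic_mul R a Q Qb D hF, fluctuationIntegral_psiBar_mul_psi]

end TwoPoint

/-! ### §7 Dimock (45)–(48): the one-step flow of the generating function -/

section Flow

variable {J : Type*} [LinearOrder J] [Fintype J]
variable {p : Type*} [Fintype p]

omit [LinearOrder m] [LinearOrder n] [Fintype n] [LinearOrder J] [Fintype J] in
/-- **Dimock's generating function (44)** as an element of an ambient Grassmann algebra:
`Ω = Z · exp(−(Ψ̄, DΨ) + (η̄, HΨ) + (Ψ̄H̄, η) + (η̄, Sη))`
  `= Z • exp(−Σ_{ij} D_{ij} Ψ̄_iΨ_j + Σ_{aj} H_{aj} η̄_aΨ_j + Σ_{ib} H̄_{ib} Ψ̄_iη_b + Σ_{ab} S_{ab} η̄_aη_b)`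
for a field `Ψ̄, Ψ` indexed by `m`, sources `η̄, η` indexed by `p` (given as elements of the algebra),
a normalisation `Z`, an action `D` (Dimock's `D_k(A)`), source couplings `H` (his `H_k(A)` on `Ψ_k`),
`H̄` (his `H_k(A)` on `Ψ̄_k`, written as a matrix acting from the right: `(Ψ̄H̄)_b = Σ_i Ψ̄_i H̄_{ib}`) and
a source two-point matrix `S` (his `S_k(A)`).  With `Z = 1`, `H = H̄ = 1`, `S = 0` it is the integrand
`exp(−(Ψ̄, DΨ) + (η̄, Ψ) + (Ψ̄, η))` of (43) (`generatingFn_one_one_one_zero`; Dimock p.9 L26: *"The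
convention is that `S_0(A) = 0`, `H_0(A) = I`, and `D_0(A) = D_{e_0}(A) + m_0`"*).
[cite: Dimock2004QED3TorusII, §1.3.3 (44) p.8] -/
def generatingFn (Z : R) (D : Matrix m m R) (H : Matrix p m R) (Hb : Matrix m p R)
    (S : Matrix p p R) (Ψb Ψ : m → GrassmannAlgebra R J) (ηb η : p → GrassmannAlgebra R J) :
    GrassmannAlgebra R J :=
  Z • grassmannExp (-(∑ i, ∑ j, D i j • (Ψb i * Ψ j)) + ∑ a, ∑ j, H a j • (ηb a * Ψ j) +
    ∑ i, ∑ b, Hb i b • (Ψb i * η b) + ∑ a, ∑ b, S a b • (ηb a * η b))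

omit [LinearOrder m] [LinearOrder n] [Fintype n] [LinearOrder J] [Fintype J] in
/-- Unfolding `generatingFn` (the form (44)). [cite: Dimock2004QED3TorusII, §1.3.3 (44) p.8] -/
theorem generatingFn_def (Z : R) (D : Matrix m m R) (H : Matrix p m R) (Hb : Matrix m p R)
    (S : Matrix p p R) (Ψb Ψ : m → GrassmannAlgebra R J) (ηb η : p → GrassmannAlgebra R J) :
    generatingFn R Z D H Hb S Ψb Ψ ηb η =
      Z • grassmannExp (-(∑ i, ∑ j, D i j • (Ψb i * Ψ j)) + ∑ a, ∑ j, H a j • (ηb a * Ψ j) +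
        ∑ i, ∑ b, Hb i b • (Ψb i * η b) + ∑ a, ∑ b, S a b • (ηb a * η b)) := rfl

omit [LinearOrder n] [Fintype n] [LinearOrder J] [Fintype J] in
/-- **The initial convention** (Dimock p.9 L26, *"`S_0(A) = 0`, `H_0(A) = I`"*): with `Z = 1`,
`H = H̄ = 1`, `S = 0` the generating function is the integrand `exp(−(Ψ̄, DΨ) + (η̄, Ψ) + (Ψ̄, η))`
of (43). [cite: Dimock2004QED3TorusII, §1.3.3 (43) p.8] -/
theorem generatingFn_one_one_one_zero (D : Matrix m m R) (Ψb Ψ ηb η : m → GrassmannAlgebra R J) :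
    generatingFn R 1 D (1 : Matrix m m R) (1 : Matrix m m R) (0 : Matrix m m R) Ψb Ψ ηb η =
      grassmannExp (-(∑ i, ∑ j, D i j • (Ψb i * Ψ j)) + ∑ i, (ηb i * Ψ i + Ψb i * η i)) := by
  rw [generatingFn, one_smul]
  congr 1
  simp only [Matrix.one_apply, Matrix.zero_apply, zero_smul, Finset.sum_const_zero, add_zero,
    ite_smul, one_smul, Finset.sum_ite_eq, Finset.mem_univ, if_true, Finset.sum_add_distrib]
  abel

/-! #### Bilinear bookkeeping -/

omit [LinearOrder m] [Fintype m] [LinearOrder n] [Fintype n] [Algebra ℚ R] [LinearOrder J]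
  [Fintype J] [Fintype p] in
/-- `Σ_{ij} C_{ij} (Σ_a K_{ai} x_a) y_j = Σ_{aj} (KC)_{aj} x_a y_j`. [folklore] -/
private theorem sum_sum_smul_sum_smul_mul {α β γ : Type*} [Fintype α] [Fintype β] [Fintype γ]
    (C : Matrix α β R) (K : Matrix γ α R) (x : γ → GrassmannAlgebra R J)
    (y : β → GrassmannAlgebra R J) :
    ∑ i, ∑ j, C i j • ((∑ a, K a i • x a) * y j) = ∑ a, ∑ j, (K * C) a j • (x a * y j) := by
  simp only [Finset.sum_mul, smul_mul_assoc, Finset.smul_sum, smul_smul, Matrix.mul_apply,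
    Finset.sum_smul]
  calc ∑ i, ∑ j, ∑ a, (C i j * K a i) • (x a * y j)
      = ∑ i, ∑ a, ∑ j, (C i j * K a i) • (x a * y j) :=
        Finset.sum_congr rfl fun _ _ => Finset.sum_comm
    _ = ∑ a, ∑ i, ∑ j, (C i j * K a i) • (x a * y j) := Finset.sum_comm
    _ = ∑ a, ∑ j, ∑ i, (C i j * K a i) • (x a * y j) :=
        Finset.sum_congr rfl fun _ _ => Finset.sum_comm
    _ = _ := by
        refine Finset.sum_congr rfl fun a _ => Finset.sum_congr rfl fun j _ =>
          Finset.sum_congr rfl fun i _ => ?_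
        rw [mul_comm]

omit [LinearOrder m] [Fintype m] [LinearOrder n] [Fintype n] [Algebra ℚ R] [LinearOrder J]
  [Fintype J] [Fintype p] in
/-- `Σ_{ij} C_{ij} x_i (Σ_b K_{jb} y_b) = Σ_{ib} (CK)_{ib} x_i y_b`. [folklore] -/
private theorem sum_sum_smul_mul_sum_smul {α β γ : Type*} [Fintype α] [Fintype β] [Fintype γ]
    (C : Matrix α β R) (K : Matrix β γ R) (x : α → GrassmannAlgebra R J)
    (y : γ → GrassmannAlgebra R J) :
    ∑ i, ∑ j, C i j • (x i * ∑ b, K j b • y b) = ∑ i, ∑ b, (C * K) i b • (x i * y b) := by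
  simp only [Finset.mul_sum, mul_smul_comm, Finset.smul_sum, smul_smul, Matrix.mul_apply,
    Finset.sum_smul]
  refine Finset.sum_congr rfl fun i _ => ?_
  rw [Finset.sum_comm]

omit [LinearOrder m] [LinearOrder n] [Fintype n] [Algebra ℚ R] [LinearOrder J] [Fintype J] in
/-- Repackaging `(η̄, HΨ)` as fine sources: `Σ_{aj} H_{aj} η̄_aΨ_j = Σ_j (η̄H)_j Ψ_j` with the composite
degree-one source `(η̄H)_j = ι(Σ_a H_{aj} v̄_a)`. [folklore] -/
private theorem sum_sum_smul_ι_mul_eq (H : Matrix p m R) (vbar : p → J → R)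
    (Ψ : m → GrassmannAlgebra R J) :
    ∑ a, ∑ j, H a j • (ι R (vbar a) * Ψ j) = ∑ j, ι R (∑ a, H a j • vbar a) * Ψ j := by
  simp only [map_sum, map_smul, Finset.sum_mul, smul_mul_assoc]
  exact Finset.sum_comm

omit [LinearOrder m] [LinearOrder n] [Fintype n] [Algebra ℚ R] [LinearOrder J] [Fintype J] in
/-- Repackaging `(Ψ̄H̄, η)` as fine sources: `Σ_{ib} H̄_{ib} Ψ̄_iη_b = Σ_i Ψ̄_i (H̄η)_i` with the composite
degree-one source `(H̄η)_i = ι(Σ_b H̄_{ib} v_b)`. [folklore] -/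
private theorem sum_sum_smul_mul_ι_eq (Hb : Matrix m p R) (v : p → J → R)
    (Ψb : m → GrassmannAlgebra R J) :
    ∑ i, ∑ b, Hb i b • (Ψb i * ι R (v b)) = ∑ i, Ψb i * ι R (∑ b, Hb i b • v b) := by
  simp only [map_sum, map_smul, Finset.mul_sum, mul_smul_comm]

omit [Fintype J] [LinearOrder n] [Fintype n] [Algebra ℚ R] in
/-- The fine quadratic action placed in the ambient algebra: `e_*(Ψ̄BΨ) = Σ B_{ij} Ψ̄_iΨ_j`.
[folklore] -/
private theorem map_extendByZero_quadratic_eq_sum' (e : m ⊕ₗ m ↪o J) (B : Matrix m m R) :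
    ExteriorAlgebra.map (Function.ExtendByZero.linearMap R e) (quadratic R B) =
      ∑ i, ∑ j, B i j • (psiBarOf R e i * psiOf R e j) := by
  simp only [quadratic, map_sum, map_smul, map_mul, psiBar, psi, map_extendByZero_gen']

omit [LinearOrder m] [Fintype m] [LinearOrder n] [Fintype n] [Algebra ℚ R] [LinearOrder J]
  [Fintype J] [Fintype p] in
/-- A rectangular bilinear `Σ_{ij} C_{ij} ι(u_i)ι(w_j)` in degree-one elements is central …
[folklore] -/
private theorem commute_sum_sum_smul_ι_mul_ι_rect {α β : Type*} [Fintype α] [Fintype β] (C : Matrix α β R)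
    (u : α → J → R) (w : β → J → R) (z : GrassmannAlgebra R J) :
    Commute (∑ i, ∑ j, C i j • (ι R (u i) * ι R (w j))) z :=
  Commute.sum_left _ _ _ fun _ _ => Commute.sum_left _ _ _ fun _ _ =>
    Commute.smul_left (commute_ι_mul_ι _ _ _) _

omit [LinearOrder m] [Fintype m] [LinearOrder n] [Fintype n] [Algebra ℚ R] [LinearOrder J]
  [Fintype J] [Fintype p] in
/-- … and nilpotent. [folklore] -/
private theorem isNilpotent_sum_sum_smul_ι_mul_ι_rect {α β : Type*} [Fintype α] [Fintype β]
    (C : Matrix α β R) (u : α → J → R) (w : β → J → R) :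
    IsNilpotent (∑ i, ∑ j, C i j • (ι R (u i) * ι R (w j))) := by
  refine Commute.isNilpotent_sum (fun _ _ => ?_) fun _ _ _ _ =>
    Commute.sum_left _ _ _ fun _ _ => Commute.smul_left (commute_ι_mul_ι _ _ _) _
  refine Commute.isNilpotent_sum (fun _ _ => ⟨2, ?_⟩) fun _ _ _ _ =>
    Commute.smul_left (commute_ι_mul_ι _ _ _) _
  rw [pow_two, smul_mul_smul_comm, ι_mul_ι_mul_self, smul_zero]

omit [LinearOrder m] [Fintype m] [LinearOrder n] [Fintype n] [Algebra ℚ R] [LinearOrder J]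
  [Fintype J] [Fintype p] in
/-- Four pairwise-commuting nilpotents (here: central ones) have a nilpotent sum. [folklore] -/
private theorem isNilpotent_add_add_add_of_central {a b c d : GrassmannAlgebra R J}
    (hb : ∀ z, Commute b z) (hc : ∀ z, Commute c z) (hd : ∀ z, Commute d z)
    (na : IsNilpotent a) (nb : IsNilpotent b) (nc : IsNilpotent c) (nd : IsNilpotent d) :
    IsNilpotent (a + b + c + d) :=
  Commute.isNilpotent_add (hd _).symm
    (Commute.isNilpotent_add (hc _).symm (Commute.isNilpotent_add (hb _).symm na nb) nc) nd

/-! #### (44) restated, and the flow (45)–(48) -/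

/-- **(44) in the vocabulary of `generatingFn`** (§5 restated): the block-spin transform of the
integrand of (43) is the generating function with `Z = ε det(−F)`, `D = D₁ = blockDirac`,
`H = cF⁻¹Q̄ = fluctShiftMat`, `H̄ = cQF⁻¹ = fluctShiftBarMat`, `S = F⁻¹`, `F = D + cQ̄Q`.
[cite: Dimock2004QED3TorusII, §1.3.3 (43)–(44) p.8] -/
theorem berezinOn_blockWeight_mul_grassmannExp_sources_eq_generatingFn (e : m ⊕ₗ m ↪o J) (c : R)
    (Q : Matrix n m R) (Qb : Matrix m n R) (D : Matrix m m R)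
    (hF : IsUnit (fluctuationOp c Q Qb D).det)
    (ab a : n → J → R) (hab : ∀ y k, ab y (e k) = 0) (ha : ∀ y k, a y (e k) = 0)
    (vbar v : m → J → R) (hvbar : ∀ i k, vbar i (e k) = 0) (hv : ∀ i k, v i (e k) = 0) :
    berezinOn R (Finset.univ.map e.toEmbedding)
        (grassmannExp (-(c • ∑ y, (ι R (ab y) - ∑ i, Qb i y • psiBarOf R e i) *
            (ι R (a y) - ∑ j, Q y j • psiOf R e j))) *
          grassmannExp (ExteriorAlgebra.map (Function.ExtendByZero.linearMap R e) (quadratic R (-D)) +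
            ∑ i, (ι R (vbar i) * psiOf R e i + psiBarOf R e i * ι R (v i)))) =
      generatingFn R
        ((-1 : R) ^ (Fintype.card m * (Fintype.card m - 1) / 2) * (-fluctuationOp c Q Qb D).det)
        (blockDirac c Q Qb D) (fluctShiftMat R c Q Qb D) (fluctShiftBarMat R c Q Qb D)
        (fluctuationOp c Q Qb D)⁻¹
        (fun y => ι R (ab y)) (fun y => ι R (a y)) (fun i => ι R (vbar i)) (fun j => ι R (v j)) := by
  rw [generatingFn]
  exact berezinOn_blockWeight_mul_grassmannExp_quadratic_add_sources R e c Q Qb D hF ab a hab ha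
    vbar v hvbar hv

/-- **Dimock (45)–(48): the one-step flow of the generating function.**  One more Gaussian
block-spin step applied to a generating function of the form (44) in the fine field `Ψ̄ = psiBarOf e`,
`Ψ = psiOf e` (data `Z, D, H, H̄, S`; sources `η̄_a = ι(v̄_a)`, `η_b = ι(v_b)` and block field
`Φ̄_y = ι(ab y)`, `Φ_y = ι(a y)` degree-one spectators) is again of the form (44), in the block field,
with the data of (46)–(48): writing `Γ = (D + cQ̄Q)⁻¹` (46, first line; the tree's `F⁻¹`,
`F = fluctuationOp c Q Q̄ D`) and `H_step = cΓQ̄` ∕ `H̄_step = cQΓ` (46, second line; the tree's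
`fluctShiftMat` ∕ `fluctShiftBarMat`),
`∫dθ_s e^{−cΣ_y(Φ̄_y − (Ψ̄Q̄)_y)(Φ_y − (QΨ)_y)} · Ω[Z, D, H, H̄, S](Ψ̄, Ψ; η̄, η)
   = Ω[Z · ε det(−F), c − c²QΓQ̄, H·H_step, H̄_step·H̄, S + HΓH̄](Φ̄, Φ; η̄, η)`,
i.e. printed (47) `S_{k+1} = S_k + H_kΓ_kH_kᵀ`, `H_{k+1} = H_kH_k`, `D_{k+1} = b − b²QΓ_kQᵀ` and (48)
`Z_{k+1} = Z_k ∫ e^{−(Ψ̄_k, Γ_k⁻¹Ψ_k)} dΨ_k` (`= Z_k · ε det(−F)` for the tree's unnormalised Berezin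
integral, `ε = (−1)^{|m|(|m|−1)/2}`; no `M⁻¹_{k+1,b}`), WITHOUT the rescaling `σ_L`: the tree's lattices
are abstract finite index types (`m` fine, `n` block, `p` sources), so the step is stated directly
between them and the conjugations by `σ_L`, `(σ_L⁻¹)ᵀ` of (45) ∕ (47) are absent.  Proof as printed
(p.9 L1–12: *"Put in the expression for `Ω_k` and evaluate this by introducing `Γ_k(A)` … and making
the transformation `Ψ_k → Ψ_k + H_k(A_L)Ψ_{k+1,L}` … by comparing we find (47)"*): the terms
`(η̄, HΨ) + (Ψ̄H̄, η)` of `Ω_k` are fine sources with the composite degree-one spectators `η̄H`, `H̄η`,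
the factor `e^{(η̄, Sη)}` is a central spectator and leaves the integral, and §5 (which performs exactly
that transformation) evaluates the rest; expanding the composite sources gives (47)–(48).
[cite: Dimock2004QED3TorusII, §1.3.3 (45)–(48) pp.8–9] -/
theorem berezinOn_blockWeight_mul_generatingFn (e : m ⊕ₗ m ↪o J) (c : R)
    (Q : Matrix n m R) (Qb : Matrix m n R) (Z : R) (D : Matrix m m R)
    (H : Matrix p m R) (Hb : Matrix m p R) (S : Matrix p p R)
    (hF : IsUnit (fluctuationOp c Q Qb D).det)
    (ab a : n → J → R) (hab : ∀ y k, ab y (e k) = 0) (ha : ∀ y k, a y (e k) = 0)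
    (vbar v : p → J → R) (hvbar : ∀ i k, vbar i (e k) = 0) (hv : ∀ i k, v i (e k) = 0) :
    berezinOn R (Finset.univ.map e.toEmbedding)
        (grassmannExp (-(c • ∑ y, (ι R (ab y) - ∑ i, Qb i y • psiBarOf R e i) *
            (ι R (a y) - ∑ j, Q y j • psiOf R e j))) *
          generatingFn R Z D H Hb S (psiBarOf R e) (psiOf R e)
            (fun a' => ι R (vbar a')) (fun b => ι R (v b))) =
      generatingFn R
        (Z * ((-1 : R) ^ (Fintype.card m * (Fintype.card m - 1) / 2) * (-fluctuationOp c Q Qb D).det))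
        (blockDirac c Q Qb D) (H * fluctShiftMat R c Q Qb D) (fluctShiftBarMat R c Q Qb D * Hb)
        (S + H * (fluctuationOp c Q Qb D)⁻¹ * Hb)
        (fun y => ι R (ab y)) (fun y => ι R (a y)) (fun a' => ι R (vbar a')) (fun b => ι R (v b)) := by
  -- notation
  set F := fluctuationOp c Q Qb D with hFdef
  set s : Finset J := Finset.univ.map e.toEmbedding with hs
  set W : GrassmannAlgebra R J := -(c • ∑ y, (ι R (ab y) - ∑ i, Qb i y • psiBarOf R e i) *
      (ι R (a y) - ∑ j, Q y j • psiOf R e j)) with hW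
  -- the composite sources `η̄H`, `H̄η`
  set vbar' : m → J → R := fun j => ∑ a', H a' j • vbar a' with hvbar'
  set v' : m → J → R := fun i => ∑ b, Hb i b • v b with hv'
  have hvbar'0 : ∀ j k, vbar' j (e k) = 0 := fun j k => by
    simp only [hvbar', Finset.sum_apply, Pi.smul_apply, hvbar, smul_zero, Finset.sum_const_zero]
  have hv'0 : ∀ i k, v' i (e k) = 0 := fun i k => by
    simp only [hv', Finset.sum_apply, Pi.smul_apply, hv, smul_zero, Finset.sum_const_zero]
  have hιvbar' : ∀ j, ι R (vbar' j) = ∑ a', H a' j • ι R (vbar a') := fun j => by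
    simp only [hvbar', map_sum, map_smul]
  have hιv' : ∀ i, ι R (v' i) = ∑ b, Hb i b • ι R (v b) := fun i => by
    simp only [hv', map_sum, map_smul]
  set A : GrassmannAlgebra R J :=
    ExteriorAlgebra.map (Function.ExtendByZero.linearMap R e) (quadratic R (-D)) with hA
  set Sv : GrassmannAlgebra R J :=
    ∑ i, (ι R (vbar' i) * psiOf R e i + psiBarOf R e i * ι R (v' i)) with hSv
  set T : GrassmannAlgebra R J := ∑ a', ∑ b, S a' b • (ι R (vbar a') * ι R (v b)) with hT
  -- Step 1: the exponent of `Ω_k` is `(A + Sv) + T`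
  have hAeq : A = -(∑ i, ∑ j, D i j • (psiBarOf R e i * psiOf R e j)) := by
    rw [hA, map_extendByZero_quadratic_eq_sum']
    simp only [Matrix.neg_apply, neg_smul, Finset.sum_neg_distrib]
  have h1 : -(∑ i, ∑ j, D i j • (psiBarOf R e i * psiOf R e j)) +
        ∑ a', ∑ j, H a' j • (ι R (vbar a') * psiOf R e j) +
        ∑ i, ∑ b, Hb i b • (psiBarOf R e i * ι R (v b)) +
        ∑ a', ∑ b, S a' b • (ι R (vbar a') * ι R (v b)) = A + Sv + T := by
    rw [hAeq, hSv, hT, Finset.sum_add_distrib, sum_sum_smul_ι_mul_eq, sum_sum_smul_mul_ι_eq]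
    abel
  -- centrality ∕ nilpotency
  have hcA : ∀ z, Commute A z := fun z =>
    commute_map_quadratic R (ExteriorAlgebra.map (Function.ExtendByZero.linearMap R e)) (-D)
      (fun x y z => by
        rw [gen, gen, ExteriorAlgebra.map_apply_ι, ExteriorAlgebra.map_apply_ι]
        exact commute_ι_mul_ι _ _ z) z
  have hnA : IsNilpotent A := (isNilpotent_quadratic R (-D)).map _
  have hnSv : IsNilpotent Sv := by
    rw [hSv]
    refine Commute.isNilpotent_sum (fun i _ => ?_) fun i j _ _ => ?_
    · refine Commute.isNilpotent_add ?_ ⟨2, ?_⟩ ⟨2, ?_⟩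
      · exact commute_ι_mul_ι _ _ _
      · rw [pow_two]; exact ι_mul_ι_mul_self _ _
      · rw [pow_two]; exact ι_mul_ι_mul_self _ _
    · exact Commute.add_left (commute_ι_mul_ι _ _ _) (commute_ι_mul_ι _ _ _)
  have hcT : ∀ z, Commute T z := fun z => commute_sum_sum_smul_ι_mul_ι _ _ _ z
  have hnT : IsNilpotent T := isNilpotent_sum_sum_smul_ι_mul_ι _ _ _
  have hY : IsNilpotent (A + Sv) := Commute.isNilpotent_add (hcA _) hnA hnSv
  -- Step 2: `exp((A + Sv) + T) = exp(A + Sv) · exp T`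
  have h2 : grassmannExp (A + Sv + T) = grassmannExp (A + Sv) * grassmannExp T := by
    rw [grassmannExp, grassmannExp, grassmannExp]
    exact IsNilpotent.exp_add_of_commute ((hcT _).symm) hY hnT
  -- Step 3: `exp T` is a central spectator
  have hTmem : grassmannExp T ∈ spectatorSubalgebra R s := by
    refine exp_mem_of_mem ?_ hnT
    rw [hT]
    refine Subalgebra.sum_mem _ fun a' _ => Subalgebra.sum_mem _ fun b _ =>
      Subalgebra.smul_mem _ (Subalgebra.mul_mem _ (ι_mem_spectatorSubalgebra R fun i hi => ?_)
        (ι_mem_spectatorSubalgebra R fun i hi => ?_)) _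
    · obtain ⟨k, -, rfl⟩ := Finset.mem_map.1 hi; exact hvbar a' k
    · obtain ⟨k, -, rfl⟩ := Finset.mem_map.1 hi; exact hv b k
  have hTcomm : ∀ z, Commute (grassmannExp T) z := commute_exp_of_forall_commute hcT hnT
  -- Step 5: the exponent of `Ω_{k+1}` — four central nilpotent pieces
  set P1 : GrassmannAlgebra R J :=
    -(∑ y, ∑ y', blockDirac c Q Qb D y y' • (ι R (ab y) * ι R (a y'))) with hP1
  set P2 : GrassmannAlgebra R J :=
    ∑ i, ∑ y, fluctShiftMat R c Q Qb D i y • (ι R (vbar' i) * ι R (a y)) with hP2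
  set P3 : GrassmannAlgebra R J :=
    ∑ y, ∑ i, fluctShiftBarMat R c Q Qb D y i • (ι R (ab y) * ι R (v' i)) with hP3
  set P4 : GrassmannAlgebra R J := ∑ i, ∑ j, F⁻¹ i j • (ι R (vbar' i) * ι R (v' j)) with hP4
  have hcP1 : ∀ z, Commute P1 z := fun z => by
    rw [hP1]; exact (commute_sum_sum_smul_ι_mul_ι_rect R _ _ _ z).neg_left
  have hcP2 : ∀ z, Commute P2 z := fun z => by
    rw [hP2]; exact commute_sum_sum_smul_ι_mul_ι_rect R _ _ _ z
  have hcP3 : ∀ z, Commute P3 z := fun z => by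
    rw [hP3]; exact commute_sum_sum_smul_ι_mul_ι_rect R _ _ _ z
  have hcP4 : ∀ z, Commute P4 z := fun z => by
    rw [hP4]; exact commute_sum_sum_smul_ι_mul_ι_rect R _ _ _ z
  have hnE5 : IsNilpotent (P1 + P2 + P3 + P4) := by
    refine isNilpotent_add_add_add_of_central R hcP2 hcP3 hcP4 ?_ ?_ ?_ ?_
    · rw [hP1]; exact (isNilpotent_sum_sum_smul_ι_mul_ι_rect R _ _ _).neg
    · rw [hP2]; exact isNilpotent_sum_sum_smul_ι_mul_ι_rect R _ _ _
    · rw [hP3]; exact isNilpotent_sum_sum_smul_ι_mul_ι_rect R _ _ _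
    · rw [hP4]; exact isNilpotent_sum_sum_smul_ι_mul_ι_rect R _ _ _
  have hcE5 : ∀ z, Commute (P1 + P2 + P3 + P4) z := fun z =>
    Commute.add_left (Commute.add_left (Commute.add_left (hcP1 z) (hcP2 z)) (hcP3 z)) (hcP4 z)
  -- Step 4: §5 with the composite sources (Dimock's transformation `Ψ_k → Ψ_k + H_kΨ_{k+1}`)
  have h5 : berezinOn R s (grassmannExp W * grassmannExp (A + Sv)) =
      ((-1 : R) ^ (Fintype.card m * (Fintype.card m - 1) / 2) * (-F).det) •
        grassmannExp (P1 + P2 + P3 + P4) :=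
    berezinOn_blockWeight_mul_grassmannExp_quadratic_add_sources R e c Q Qb D hF ab a hab ha
      vbar' v' hvbar'0 hv'0
  have h6 : P1 + P2 + P3 + P4 + T =
      -(∑ y, ∑ y', blockDirac c Q Qb D y y' • (ι R (ab y) * ι R (a y'))) +
        ∑ a', ∑ y, (H * fluctShiftMat R c Q Qb D) a' y • (ι R (vbar a') * ι R (a y)) +
        ∑ y, ∑ b, (fluctShiftBarMat R c Q Qb D * Hb) y b • (ι R (ab y) * ι R (v b)) +
        ∑ a', ∑ b, (S + H * F⁻¹ * Hb) a' b • (ι R (vbar a') * ι R (v b)) := by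
    rw [hP1, hP2, hP3, hP4, hT]
    simp only [hιvbar', hιv']
    rw [sum_sum_smul_sum_smul_mul, sum_sum_smul_mul_sum_smul, sum_sum_smul_sum_smul_mul,
      sum_sum_smul_mul_sum_smul]
    have hS : ∑ a', ∑ b, (H * F⁻¹ * Hb) a' b • (ι R (vbar a') * ι R (v b)) +
        ∑ a', ∑ b, S a' b • (ι R (vbar a') * ι R (v b)) =
        ∑ a', ∑ b, (S + H * F⁻¹ * Hb) a' b • (ι R (vbar a') * ι R (v b)) := by
      rw [← Finset.sum_add_distrib]
      refine Finset.sum_congr rfl fun a' _ => ?_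
      rw [← Finset.sum_add_distrib]
      refine Finset.sum_congr rfl fun b _ => ?_
      rw [← add_smul, Matrix.add_apply, add_comm]
    rw [← hS]
    abel
  -- assemble
  rw [generatingFn, generatingFn, h1, h2, mul_smul_comm, LinearMap.map_smul,
    ← mul_assoc (grassmannExp W),
    berezinOn_mul_of_mem_spectatorSubalgebra_of_commute R hTmem hTcomm, h5, smul_mul_assoc,
    grassmannExp, grassmannExp, ← IsNilpotent.exp_add_of_commute (hcE5 _) hnE5 hnT, h6, smul_smul,
    grassmannExp]


/-- **(44) is the first step of the flow**: with Dimock's initial convention `Z = 1`, `H = H̄ = I`,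
`S = 0` (p.9 L26) the one-step flow reproduces §5 ∕ (44): `Z_1 = ε det(−F)`, `D_1 = D₁`,
`H_1 = cF⁻¹Q̄`, `H̄_1 = cQF⁻¹`, `S_1 = F⁻¹`. [cite: Dimock2004QED3TorusII, §1.3.3 (44)–(47) pp.8–9] -/
theorem berezinOn_blockWeight_mul_generatingFn_init (e : m ⊕ₗ m ↪o J) (c : R)
    (Q : Matrix n m R) (Qb : Matrix m n R) (D : Matrix m m R)
    (hF : IsUnit (fluctuationOp c Q Qb D).det)
    (ab a : n → J → R) (hab : ∀ y k, ab y (e k) = 0) (ha : ∀ y k, a y (e k) = 0)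
    (vbar v : m → J → R) (hvbar : ∀ i k, vbar i (e k) = 0) (hv : ∀ i k, v i (e k) = 0) :
    berezinOn R (Finset.univ.map e.toEmbedding)
        (grassmannExp (-(c • ∑ y, (ι R (ab y) - ∑ i, Qb i y • psiBarOf R e i) *
            (ι R (a y) - ∑ j, Q y j • psiOf R e j))) *
          generatingFn R 1 D (1 : Matrix m m R) (1 : Matrix m m R) (0 : Matrix m m R)
            (psiBarOf R e) (psiOf R e) (fun a' => ι R (vbar a')) (fun b => ι R (v b))) =
      generatingFn R
        ((-1 : R) ^ (Fintype.card m * (Fintype.card m - 1) / 2) * (-fluctuationOp c Q Qb D).det)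
        (blockDirac c Q Qb D) (fluctShiftMat R c Q Qb D) (fluctShiftBarMat R c Q Qb D)
        (fluctuationOp c Q Qb D)⁻¹
        (fun y => ι R (ab y)) (fun y => ι R (a y)) (fun a' => ι R (vbar a')) (fun b => ι R (v b)) := by
  rw [berezinOn_blockWeight_mul_generatingFn R e c Q Qb 1 D 1 1 0 hF ab a hab ha vbar v hvbar hv,
    one_mul, Matrix.one_mul, Matrix.mul_one, Matrix.one_mul, Matrix.mul_one, zero_add]

/-! #### §1.3.4: iterating the step — the flow `(Z_k, D_k, H_k, S_k)` and (50)–(51) -/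

section Tower

variable (𝓘 : ℕ → Type*) [∀ k, LinearOrder (𝓘 k)] [∀ k, Fintype (𝓘 k)]
variable (c : ℕ → R) (Qs : (k : ℕ) → Matrix (𝓘 (k + 1)) (𝓘 k) R)
  (Qbs : (k : ℕ) → Matrix (𝓘 k) (𝓘 (k + 1)) R) (D₀ : Matrix (𝓘 0) (𝓘 0) R)

omit [LinearOrder m] [Fintype m] [LinearOrder n] [Fintype n] [Algebra ℚ R] in
/-- **The flow of the block action `D_k(A)`** along a tower of block-spin steps with weights `c k`
and averaging operators `Qs k`, `Qbs k` (Dimock (47), third line, unscaled):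
`D_0 = D₀` (*"`D_0(A) = D_{e_0}(A) + m_0`"*, p.9 L26) and `D_{k+1} = c_k − c_k² Q_k Γ_k Q̄_k`
(`blockDirac`). [cite: Dimock2004QED3TorusII, §1.3.3 (47) p.9] -/
def flowD : (k : ℕ) → Matrix (𝓘 k) (𝓘 k) R
  | 0 => D₀
  | k + 1 => blockDirac (c k) (Qs k) (Qbs k) (flowD k)

omit [LinearOrder m] [Fintype m] [LinearOrder n] [Fintype n] [Algebra ℚ R] in
/-- **The fluctuation covariance `Γ_k(A) = (D_k(A) + c_k Q̄_kQ_k)⁻¹`** of the `k`-th step (Dimock (46),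
first line; the tree's `(fluctuationOp …)⁻¹`). [cite: Dimock2004QED3TorusII, §1.3.3 (46) p.9] -/
def flowGamma (k : ℕ) : Matrix (𝓘 k) (𝓘 k) R :=
  (fluctuationOp (c k) (Qs k) (Qbs k) (flowD R 𝓘 c Qs Qbs D₀ k))⁻¹

omit [LinearOrder m] [Fintype m] [LinearOrder n] [Fintype n] in
/-- **The flow of the source coupling `H_k(A)` on `Ψ_k`** (Dimock (47), second line, unscaled):
`H_0 = I` and `H_{k+1} = H_k · (c_kΓ_kQ̄_k)` (`fluctShiftMat`), a matrix from the original fine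
lattice `𝓘 0` (where the sources live) to the level-`k` lattice. [cite: Dimock2004QED3TorusII, §1.3.3 (47) p.9] -/
def flowH : (k : ℕ) → Matrix (𝓘 0) (𝓘 k) R
  | 0 => 1
  | k + 1 => flowH k * fluctShiftMat R (c k) (Qs k) (Qbs k) (flowD R 𝓘 c Qs Qbs D₀ k)

omit [LinearOrder m] [Fintype m] [LinearOrder n] [Fintype n] in
/-- **The flow of the source coupling `H_k(A)` on `Ψ̄_k`** (Dimock (47), second line, unscaled; the
conjugate half of (40) ∕ (46), acting from the right): `H̄_0 = I`, `H̄_{k+1} = (c_kQ_kΓ_k) · H̄_k`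
(`fluctShiftBarMat`). [cite: Dimock2004QED3TorusII, §1.3.3 (47) p.9] -/
def flowHb : (k : ℕ) → Matrix (𝓘 k) (𝓘 0) R
  | 0 => 1
  | k + 1 => fluctShiftBarMat R (c k) (Qs k) (Qbs k) (flowD R 𝓘 c Qs Qbs D₀ k) * flowHb k

omit [LinearOrder m] [Fintype m] [LinearOrder n] [Fintype n] in
/-- **The flow of the fermion propagator `S_k(A)`** (Dimock (47), first line, unscaled): `S_0 = 0`
and `S_{k+1} = S_k + H_kΓ_kH̄_k`. [cite: Dimock2004QED3TorusII, §1.3.3 (47) p.9] -/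
def flowS : ℕ → Matrix (𝓘 0) (𝓘 0) R
  | 0 => 0
  | k + 1 => flowS k + flowH R 𝓘 c Qs Qbs D₀ k * flowGamma R 𝓘 c Qs Qbs D₀ k * flowHb R 𝓘 c Qs Qbs D₀ k

omit [LinearOrder m] [Fintype m] [LinearOrder n] [Fintype n] [Algebra ℚ R] in
/-- **The flow of the normalisation `Z_k(A)`** (Dimock (48), with the tree's unnormalised Berezin
integral: `∫dΨ̄dΨ e^{−(Ψ̄, Γ_k⁻¹Ψ)} = ε_k det(−Γ_k⁻¹)`, `ε_k = (−1)^{|𝓘 k|(|𝓘 k|−1)/2}`, no `M⁻¹_{k+1,b}`):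
`Z_0 = 1`, `Z_{k+1} = Z_k · ε_k det(−(D_k + c_kQ̄_kQ_k))`. [cite: Dimock2004QED3TorusII, §1.3.3 (48) p.9] -/
def flowZ : ℕ → R
  | 0 => 1
  | k + 1 => flowZ k * ((-1 : R) ^ (Fintype.card (𝓘 k) * (Fintype.card (𝓘 k) - 1) / 2) *
      (-fluctuationOp (c k) (Qs k) (Qbs k) (flowD R 𝓘 c Qs Qbs D₀ k)).det)

omit [LinearOrder m] [Fintype m] [LinearOrder n] [Fintype n] [Algebra ℚ R] in
/-- **Dimock (50)–(51), unscaled**: *"Iterating this yields"* `S_k = Σ_{j<k} Γ̃_j` with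
`Γ̃_j = H_jΓ_jH̄_j` (51) (printed with the rescalings: `S_k(A,x,x′) = Σ_j L^{2(k−j)} Γ̃_j(A_{L^{k−j}}; L^{k−j}x, L^{k−j}x′)`).
[cite: Dimock2004QED3TorusII, §1.3.4 (50)–(51) p.9] -/
theorem flowS_eq_sum (k : ℕ) :
    flowS R 𝓘 c Qs Qbs D₀ k = ∑ j ∈ Finset.range k,
      flowH R 𝓘 c Qs Qbs D₀ j * flowGamma R 𝓘 c Qs Qbs D₀ j * flowHb R 𝓘 c Qs Qbs D₀ j := by
  induction k with
  | zero => rw [flowS, Finset.sum_range_zero]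
  | succ k ih => rw [flowS, ih, Finset.sum_range_succ]

omit [LinearOrder m] [Fintype m] [LinearOrder n] [Fintype n] [LinearOrder J] [Fintype J] in
/-- At `k = 0` the flow data are Dimock's initial convention and the generating function is the
integrand of (43): `Ω_0 = exp(−(Ψ̄, D₀Ψ) + (η̄, Ψ) + (Ψ̄, η))`. [cite: Dimock2004QED3TorusII, §1.3.3 (43) p.8] -/
theorem generatingFn_flow_zero (Ψb Ψ ηb η : 𝓘 0 → GrassmannAlgebra R J) :
    generatingFn R (flowZ R 𝓘 c Qs Qbs D₀ 0) (flowD R 𝓘 c Qs Qbs D₀ 0) (flowH R 𝓘 c Qs Qbs D₀ 0)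
        (flowHb R 𝓘 c Qs Qbs D₀ 0) (flowS R 𝓘 c Qs Qbs D₀ 0) Ψb Ψ ηb η =
      grassmannExp (-(∑ i, ∑ j, D₀ i j • (Ψb i * Ψ j)) + ∑ i, (ηb i * Ψ i + Ψb i * η i)) := by
  rw [flowZ, flowD, flowH, flowHb, flowS]
  exact generatingFn_one_one_one_zero R D₀ Ψb Ψ ηb η

omit [LinearOrder m] [Fintype m] [LinearOrder n] [Fintype n] in
/-- **The RG flow of the generating function, step `k → k + 1`** (Dimock (45)–(48) iterated from the
initial convention, unscaled): integrating out the level-`k` field `Ψ̄_k = psiBarOf e`, `Ψ_k = psiOf e`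
against the `k`-th Gaussian block-spin weight maps `Ω_k = Ω[Z_k, D_k, H_k, H̄_k, S_k]` to
`Ω_{k+1} = Ω[Z_{k+1}, D_{k+1}, H_{k+1}, H̄_{k+1}, S_{k+1}]` in the block field, the data being the
recursively defined `flowZ ∕ flowD ∕ flowH ∕ flowHb ∕ flowS`. [cite: Dimock2004QED3TorusII, §1.3.3 (45)–(48) pp.8–9] -/
theorem berezinOn_blockWeight_mul_generatingFn_flow (k : ℕ) (e : 𝓘 k ⊕ₗ 𝓘 k ↪o J)
    (hF : IsUnit (fluctuationOp (c k) (Qs k) (Qbs k) (flowD R 𝓘 c Qs Qbs D₀ k)).det)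
    (ab a : 𝓘 (k + 1) → J → R) (hab : ∀ y l, ab y (e l) = 0) (ha : ∀ y l, a y (e l) = 0)
    (vbar v : 𝓘 0 → J → R) (hvbar : ∀ i l, vbar i (e l) = 0) (hv : ∀ i l, v i (e l) = 0) :
    berezinOn R (Finset.univ.map e.toEmbedding)
        (grassmannExp (-(c k • ∑ y, (ι R (ab y) - ∑ i, Qbs k i y • psiBarOf R e i) *
            (ι R (a y) - ∑ j, Qs k y j • psiOf R e j))) *
          generatingFn R (flowZ R 𝓘 c Qs Qbs D₀ k) (flowD R 𝓘 c Qs Qbs D₀ k)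
            (flowH R 𝓘 c Qs Qbs D₀ k) (flowHb R 𝓘 c Qs Qbs D₀ k) (flowS R 𝓘 c Qs Qbs D₀ k)
            (psiBarOf R e) (psiOf R e) (fun a' => ι R (vbar a')) (fun b => ι R (v b))) =
      generatingFn R (flowZ R 𝓘 c Qs Qbs D₀ (k + 1)) (flowD R 𝓘 c Qs Qbs D₀ (k + 1))
        (flowH R 𝓘 c Qs Qbs D₀ (k + 1)) (flowHb R 𝓘 c Qs Qbs D₀ (k + 1))
        (flowS R 𝓘 c Qs Qbs D₀ (k + 1))
        (fun y => ι R (ab y)) (fun y => ι R (a y)) (fun a' => ι R (vbar a')) (fun b => ι R (v b)) := by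
  rw [flowZ, flowD, flowH, flowHb, flowS, flowGamma, Matrix.mul_assoc (flowH R 𝓘 c Qs Qbs D₀ k)]
  rw [berezinOn_blockWeight_mul_generatingFn R e (c k) (Qs k) (Qbs k) _ _ _ _ _ hF ab a hab ha
    vbar v hvbar hv, Matrix.mul_assoc]

end Tower

end Flow

/-! ### §8 Gauge covariance (42): *"All these objects are gauge covariant"* (Dimock p.8 L54–56) -/

section GaugeCovariance

variable {J : Type*} [LinearOrder J] [Fintype J]
variable {p : Type*} [Fintype p]

/-! #### One step: `Q ↦ g′Qg⁻¹`, `Q̄ ↦ gQ̄g′⁻¹`, `D ↦ gDg⁻¹` (the tree's `fluctuationOp_conj`,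
`blockDirac_conj`) -/

omit [Algebra ℚ R] in
/-- **(42) for the fluctuation covariance, one step**: `Γ = F⁻¹ = (D + cQ̄Q)⁻¹` transforms with the fine
rotation, `Γ ↦ gΓg⁻¹` — printed *"`S_k(A + dλ) = e^{−ie_kλ} S_k(A) e^{ie_kλ}`"* (42) for `S_k = (D#_k)⁻¹`,
given the covariance `Q_k(A + dλ) = e^{ie_kλ}Q_k(A)e^{−ie_kλ}` of the averaging operators ((32), (37))
and of the Dirac operator, here abstracted into conjugations by mutually inverse matrices `g, gi`
(fine) and `g′, g′i` (block). [cite: Dimock2004QED3TorusII, §1.3.2 (42) p.8] -/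
theorem inv_fluctuationOp_conj (a : R) {g gi : Matrix m m R} (hg : gi * g = 1)
    {g' g'i : Matrix n n R} (hg' : g'i * g' = 1) (Q : Matrix n m R) (Qb : Matrix m n R)
    (D : Matrix m m R) :
    (fluctuationOp a (g' * Q * gi) (g * Qb * g'i) (g * D * gi))⁻¹ =
      g * (fluctuationOp a Q Qb D)⁻¹ * gi := by
  have hg1 : g * gi = 1 := mul_eq_one_comm.1 hg
  rw [fluctuationOp_conj a g gi hg', Matrix.mul_inv_rev, Matrix.mul_inv_rev,
    Matrix.inv_eq_left_inv hg1, Matrix.inv_eq_left_inv hg, Matrix.mul_assoc]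

omit [Algebra ℚ R] in
/-- **Gauge invariance of the normalisation, one step**: `det(−F)` (Dimock's `Z_k` (41) ∕ the factor of
(48), unnormalised) is invariant, `det(−gFg⁻¹) = det(−F)`. [cite: Dimock2004QED3TorusII, §1.3.2 (41)–(42) p.8] -/
theorem det_neg_fluctuationOp_conj (a : R) {g gi : Matrix m m R} (hg : gi * g = 1)
    {g' g'i : Matrix n n R} (hg' : g'i * g' = 1) (Q : Matrix n m R) (Qb : Matrix m n R)
    (D : Matrix m m R) :
    (-fluctuationOp a (g' * Q * gi) (g * Qb * g'i) (g * D * gi)).det = (-fluctuationOp a Q Qb D).det := by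
  have hg1 : g * gi = 1 := mul_eq_one_comm.1 hg
  rw [fluctuationOp_conj a g gi hg',
    show -(g * fluctuationOp a Q Qb D * gi) = g * (-fluctuationOp a Q Qb D) * gi by
      rw [Matrix.mul_neg, Matrix.neg_mul],
    Matrix.det_mul, Matrix.det_mul, mul_comm g.det, mul_assoc, ← Matrix.det_mul, hg1, Matrix.det_one,
    mul_one]

omit [Algebra ℚ R] in
/-- **Covariance of the source coupling `H = cF⁻¹Q̄`, one step** ((40) ∕ (46) on `Ψ`): `H ↦ gHg′⁻¹`.
[cite: Dimock2004QED3TorusII, §1.3.2 (40)–(42) p.8] -/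
theorem fluctShiftMat_conj (a : R) {g gi : Matrix m m R} (hg : gi * g = 1)
    {g' g'i : Matrix n n R} (hg' : g'i * g' = 1) (Q : Matrix n m R) (Qb : Matrix m n R)
    (D : Matrix m m R) :
    fluctShiftMat R a (g' * Q * gi) (g * Qb * g'i) (g * D * gi) =
      g * fluctShiftMat R a Q Qb D * g'i := by
  rw [fluctShiftMat, fluctShiftMat, inv_fluctuationOp_conj R a hg hg', Matrix.mul_smul,
    Matrix.smul_mul]
  congr 1
  calc g * (fluctuationOp a Q Qb D)⁻¹ * gi * (g * Qb * g'i)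
      = g * (fluctuationOp a Q Qb D)⁻¹ * (gi * g) * Qb * g'i := by simp only [Matrix.mul_assoc]
    _ = g * ((fluctuationOp a Q Qb D)⁻¹ * Qb) * g'i := by rw [hg, Matrix.mul_one, Matrix.mul_assoc g]

omit [Algebra ℚ R] in
/-- **Covariance of the source coupling `H̄ = cQF⁻¹`, one step** ((40) ∕ (46) on `Ψ̄`): `H̄ ↦ g′H̄g⁻¹`.
[cite: Dimock2004QED3TorusII, §1.3.2 (40)–(42) p.8] -/
theorem fluctShiftBarMat_conj (a : R) {g gi : Matrix m m R} (hg : gi * g = 1)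
    {g' g'i : Matrix n n R} (hg' : g'i * g' = 1) (Q : Matrix n m R) (Qb : Matrix m n R)
    (D : Matrix m m R) :
    fluctShiftBarMat R a (g' * Q * gi) (g * Qb * g'i) (g * D * gi) =
      g' * fluctShiftBarMat R a Q Qb D * gi := by
  rw [fluctShiftBarMat, fluctShiftBarMat, inv_fluctuationOp_conj R a hg hg', Matrix.mul_smul,
    Matrix.smul_mul]
  congr 1
  calc g' * Q * gi * (g * (fluctuationOp a Q Qb D)⁻¹ * gi)
      = g' * Q * (gi * g) * (fluctuationOp a Q Qb D)⁻¹ * gi := by simp only [Matrix.mul_assoc]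
    _ = g' * (Q * (fluctuationOp a Q Qb D)⁻¹) * gi := by rw [hg, Matrix.mul_one, Matrix.mul_assoc g']

omit [LinearOrder m] [LinearOrder n] [Fintype n] [LinearOrder J] [Fintype J] in
/-- **Gauge covariance of the generating function**: rotating the data
`(D, H, H̄, S) ↦ (gDg⁻¹, kHg⁻¹, gH̄k⁻¹, kSk⁻¹)` is the same as rotating the field and the sources,
`Ψ̄ ↦ Ψ̄g`, `Ψ ↦ g⁻¹Ψ`, `η̄ ↦ η̄k`, `η ↦ k⁻¹η` (bilinearity; no hypothesis on the matrices `g, gi, k, ki`).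
[cite: Dimock2004QED3TorusII, §1.3.2 (42) p.8] -/
theorem generatingFn_conj (Z : R) (D : Matrix m m R) (H : Matrix p m R) (Hb : Matrix m p R)
    (S : Matrix p p R) (g gi : Matrix m m R) (k ki : Matrix p p R)
    (Ψb Ψ : m → GrassmannAlgebra R J) (ηb η : p → GrassmannAlgebra R J) :
    generatingFn R Z (g * D * gi) (k * H * gi) (g * Hb * ki) (k * S * ki) Ψb Ψ ηb η =
      generatingFn R Z D H Hb S (fun i' => ∑ i, g i i' • Ψb i) (fun j' => ∑ j, gi j' j • Ψ j)
        (fun a' => ∑ a, k a a' • ηb a) (fun b' => ∑ b, ki b' b • η b) := by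
  rw [generatingFn, generatingFn]
  simp only [sum_sum_smul_sum_smul_mul, sum_sum_smul_mul_sum_smul]

/-! #### Along the tower: the flow data `D_k, Γ_k, H_k, H̄_k, S_k, Z_k` -/

variable (𝓘 : ℕ → Type*) [∀ k, LinearOrder (𝓘 k)] [∀ k, Fintype (𝓘 k)]
variable (c : ℕ → R) (Qs : (k : ℕ) → Matrix (𝓘 (k + 1)) (𝓘 k) R)
  (Qbs : (k : ℕ) → Matrix (𝓘 k) (𝓘 (k + 1)) R) (D₀ : Matrix (𝓘 0) (𝓘 0) R)
variable (g gi : (k : ℕ) → Matrix (𝓘 k) (𝓘 k) R)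

omit [LinearOrder m] [Fintype m] [LinearOrder n] [Fintype n] [Algebra ℚ R] in
/-- **Gauge covariance of the block actions `D_k`** along the tower (from the tree's
`blockDirac_conj`): with rotations `g k` (inverses `gi k`) on every level,
`Q_k ↦ g_{k+1}Q_kg_k⁻¹`, `Q̄_k ↦ g_kQ̄_kg_{k+1}⁻¹`, `D_0 ↦ g_0D_0g_0⁻¹` gives `D_k ↦ g_kD_kg_k⁻¹`.
[cite: Dimock2004QED3TorusII, §1.3.2 (42) p.8] -/
theorem flowD_conj (hg : ∀ k, gi k * g k = 1) (k : ℕ) :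
    flowD R 𝓘 c (fun j => g (j + 1) * Qs j * gi j) (fun j => g j * Qbs j * gi (j + 1))
        (g 0 * D₀ * gi 0) k = g k * flowD R 𝓘 c Qs Qbs D₀ k * gi k := by
  induction k with
  | zero => rfl
  | succ k ih => rw [flowD, flowD, ih, blockDirac_conj (c k) (hg k) (hg (k + 1))]

omit [LinearOrder m] [Fintype m] [LinearOrder n] [Fintype n] [Algebra ℚ R] in
/-- **(42) along the tower**: the fluctuation covariances transform as `Γ_k ↦ g_kΓ_kg_k⁻¹`.
[cite: Dimock2004QED3TorusII, §1.3.2 (42) p.8] -/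
theorem flowGamma_conj (hg : ∀ k, gi k * g k = 1) (k : ℕ) :
    flowGamma R 𝓘 c (fun j => g (j + 1) * Qs j * gi j) (fun j => g j * Qbs j * gi (j + 1))
        (g 0 * D₀ * gi 0) k = g k * flowGamma R 𝓘 c Qs Qbs D₀ k * gi k := by
  rw [flowGamma, flowGamma, flowD_conj R 𝓘 c Qs Qbs D₀ g gi hg,
    inv_fluctuationOp_conj R (c k) (hg k) (hg (k + 1))]

omit [LinearOrder m] [Fintype m] [LinearOrder n] [Fintype n] [Algebra ℚ R] in
/-- **Covariance of the accumulated couplings `H_k`**: `H_k ↦ g_0H_kg_k⁻¹`.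
[cite: Dimock2004QED3TorusII, §1.3.2 (42) p.8] -/
theorem flowH_conj (hg : ∀ k, gi k * g k = 1) (k : ℕ) :
    flowH R 𝓘 c (fun j => g (j + 1) * Qs j * gi j) (fun j => g j * Qbs j * gi (j + 1))
        (g 0 * D₀ * gi 0) k = g 0 * flowH R 𝓘 c Qs Qbs D₀ k * gi k := by
  induction k with
  | zero => rw [flowH, flowH, Matrix.mul_one, mul_eq_one_comm.1 (hg 0)]
  | succ k ih =>
    rw [flowH, flowH, ih, flowD_conj R 𝓘 c Qs Qbs D₀ g gi hg,
      fluctShiftMat_conj R (c k) (hg k) (hg (k + 1))]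
    calc g 0 * flowH R 𝓘 c Qs Qbs D₀ k * gi k *
          (g k * fluctShiftMat R (c k) (Qs k) (Qbs k) (flowD R 𝓘 c Qs Qbs D₀ k) * gi (k + 1))
        = g 0 * flowH R 𝓘 c Qs Qbs D₀ k * (gi k * g k) *
            fluctShiftMat R (c k) (Qs k) (Qbs k) (flowD R 𝓘 c Qs Qbs D₀ k) * gi (k + 1) := by
          simp only [Matrix.mul_assoc]
      _ = _ := by rw [hg, Matrix.mul_one, Matrix.mul_assoc (g 0)]

omit [LinearOrder m] [Fintype m] [LinearOrder n] [Fintype n] [Algebra ℚ R] in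
/-- **Covariance of the accumulated couplings `H̄_k`**: `H̄_k ↦ g_kH̄_kg_0⁻¹`.
[cite: Dimock2004QED3TorusII, §1.3.2 (42) p.8] -/
theorem flowHb_conj (hg : ∀ k, gi k * g k = 1) (k : ℕ) :
    flowHb R 𝓘 c (fun j => g (j + 1) * Qs j * gi j) (fun j => g j * Qbs j * gi (j + 1))
        (g 0 * D₀ * gi 0) k = g k * flowHb R 𝓘 c Qs Qbs D₀ k * gi 0 := by
  induction k with
  | zero => rw [flowHb, flowHb, Matrix.mul_one, mul_eq_one_comm.1 (hg 0)]
  | succ k ih =>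
    rw [flowHb, flowHb, ih, flowD_conj R 𝓘 c Qs Qbs D₀ g gi hg,
      fluctShiftBarMat_conj R (c k) (hg k) (hg (k + 1))]
    calc g (k + 1) * fluctShiftBarMat R (c k) (Qs k) (Qbs k) (flowD R 𝓘 c Qs Qbs D₀ k) * gi k *
          (g k * flowHb R 𝓘 c Qs Qbs D₀ k * gi 0)
        = g (k + 1) * fluctShiftBarMat R (c k) (Qs k) (Qbs k) (flowD R 𝓘 c Qs Qbs D₀ k) *
            (gi k * g k) * flowHb R 𝓘 c Qs Qbs D₀ k * gi 0 := by
          simp only [Matrix.mul_assoc]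
      _ = _ := by rw [hg, Matrix.mul_one, Matrix.mul_assoc (g (k + 1))]

omit [LinearOrder m] [Fintype m] [LinearOrder n] [Fintype n] [Algebra ℚ R] in
/-- **(42) for the propagators `S_k`**: `S_k ↦ g_0S_kg_0⁻¹` — printed
*"`S_k(A + dλ) = e^{−ie_kλ} S_k(A) e^{ie_kλ}`"*. [cite: Dimock2004QED3TorusII, §1.3.2 (42) p.8] -/
theorem flowS_conj (hg : ∀ k, gi k * g k = 1) (k : ℕ) :
    flowS R 𝓘 c (fun j => g (j + 1) * Qs j * gi j) (fun j => g j * Qbs j * gi (j + 1))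
        (g 0 * D₀ * gi 0) k = g 0 * flowS R 𝓘 c Qs Qbs D₀ k * gi 0 := by
  induction k with
  | zero => rw [flowS, flowS, Matrix.mul_zero, Matrix.zero_mul]
  | succ k ih =>
    rw [flowS, flowS, ih, flowH_conj R 𝓘 c Qs Qbs D₀ g gi hg, flowGamma_conj R 𝓘 c Qs Qbs D₀ g gi hg,
      flowHb_conj R 𝓘 c Qs Qbs D₀ g gi hg, Matrix.mul_add, Matrix.add_mul]
    congr 1
    calc g 0 * flowH R 𝓘 c Qs Qbs D₀ k * gi k * (g k * flowGamma R 𝓘 c Qs Qbs D₀ k * gi k) *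
          (g k * flowHb R 𝓘 c Qs Qbs D₀ k * gi 0)
        = g 0 * flowH R 𝓘 c Qs Qbs D₀ k * (gi k * g k) * flowGamma R 𝓘 c Qs Qbs D₀ k *
            (gi k * g k) * flowHb R 𝓘 c Qs Qbs D₀ k * gi 0 := by simp only [Matrix.mul_assoc]
      _ = _ := by simp only [hg, Matrix.mul_one, Matrix.mul_assoc]

omit [LinearOrder m] [Fintype m] [LinearOrder n] [Fintype n] [Algebra ℚ R] in
/-- **Gauge invariance of the normalisations `Z_k`**. [cite: Dimock2004QED3TorusII, §1.3.2 (41)–(42) p.8] -/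
theorem flowZ_conj (hg : ∀ k, gi k * g k = 1) (k : ℕ) :
    flowZ R 𝓘 c (fun j => g (j + 1) * Qs j * gi j) (fun j => g j * Qbs j * gi (j + 1))
        (g 0 * D₀ * gi 0) k = flowZ R 𝓘 c Qs Qbs D₀ k := by
  induction k with
  | zero => rfl
  | succ k ih =>
    rw [flowZ, flowZ, ih, flowD_conj R 𝓘 c Qs Qbs D₀ g gi hg,
      det_neg_fluctuationOp_conj R (c k) (hg k) (hg (k + 1))]

end GaugeCovariance

/-! ### §9 The `k`-fold transformation with sources: `Ω_k = T_{k−1}⋯T_0 Ω_0` by induction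
(Dimock (30) ∕ (35) with the sources of (43); *"The formula (30) is again proved by induction"*, p.7 L61) -/

section Iterated

variable {J : Type*} [LinearOrder J] [Fintype J]
variable (𝓘 : ℕ → Type*) [∀ k, LinearOrder (𝓘 k)] [∀ k, Fintype (𝓘 k)]
variable (c : ℕ → R) (Qs : (k : ℕ) → Matrix (𝓘 (k + 1)) (𝓘 k) R)
  (Qbs : (k : ℕ) → Matrix (𝓘 k) (𝓘 (k + 1)) R) (D₀ : Matrix (𝓘 0) (𝓘 0) R)
variable (es : (k : ℕ) → 𝓘 k ⊕ₗ 𝓘 k ↪o J) (vbar v : 𝓘 0 → J → R)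

omit [LinearOrder m] [Fintype m] [LinearOrder n] [Fintype n] in
/-- **The iterated block-spin integral of the generating function** in ONE ambient Grassmann algebra
`Λ(J)` carrying every level՚s fermions (level `k` placed by the order embedding `es k`) and the sources
`η̄_i = ι(v̄_i)`, `η_j = ι(v_j)`: `Ω_0 = exp(−(Ψ̄_0, D₀Ψ_0) + (η̄, Ψ_0) + (Ψ̄_0, η))` (the integrand of (43) at
`k = 0`, Dimock՚s initial convention) and
`Ω_{k+1} = ∫dθ_{level k} exp(−c_k Σ_y (Ψ̄_{k+1,y} − (Ψ̄_kQ̄_k)_y)(Ψ_{k+1,y} − (Q_kΨ_k)_y)) · Ω_k`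
— the left side of (30) with `F = e^{(η̄,Ψ_0)+(Ψ̄_0,η)}`, resp. (45) iterated, without `M⁻¹` and `σ_L`.
[cite: Dimock2004QED3TorusII, §1.3.1 (30), §1.3.3 (43)–(45) pp.7–8] -/
def iterGeneratingFn : ℕ → GrassmannAlgebra R J
  | 0 => grassmannExp (-(∑ i, ∑ j, D₀ i j • (psiBarOf R (es 0) i * psiOf R (es 0) j)) +
      ∑ i, (ι R (vbar i) * psiOf R (es 0) i + psiBarOf R (es 0) i * ι R (v i)))
  | k + 1 => berezinOn R (Finset.univ.map (es k).toEmbedding)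
      (grassmannExp (-(c k • ∑ y, (psiBarOf R (es (k + 1)) y - ∑ i, Qbs k i y • psiBarOf R (es k) i) *
          (psiOf R (es (k + 1)) y - ∑ j, Qs k y j • psiOf R (es k) j))) *
        iterGeneratingFn k)

omit [LinearOrder m] [Fintype m] [LinearOrder n] [Fintype n] in
/-- **Dimock (30) with sources ∕ (44) at every level, by induction on `k`**: if consecutive levels sit
on distinct generators, the sources avoid every level, and every fluctuation operator
`F_j = D_j + c_jQ̄_jQ_j`, `j < k`, has unit determinant (Dimock: *"provided all the operators exist"*),
then the `k`-fold iterated block-spin integral of `Ω_0` IS the level-`k` generating function (44) with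
the flow data (46)–(48): `T_{k−1}⋯T_0 Ω_0 = Ω[Z_k, D_k, H_k, H̄_k, S_k](Ψ̄_k, Ψ_k; η̄, η)`.
[cite: Dimock2004QED3TorusII, §1.3.1 (30), §1.3.3 (44)–(48) pp.7–9] -/
theorem iterGeneratingFn_eq_generatingFn (hes : ∀ k x y, es (k + 1) x ≠ es k y)
    (hvbar : ∀ i k l, vbar i (es k l) = 0) (hv : ∀ i k l, v i (es k l) = 0) (k : ℕ)
    (hF : ∀ j < k, IsUnit (fluctuationOp (c j) (Qs j) (Qbs j) (flowD R 𝓘 c Qs Qbs D₀ j)).det) :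
    iterGeneratingFn R 𝓘 c Qs Qbs D₀ es vbar v k =
      generatingFn R (flowZ R 𝓘 c Qs Qbs D₀ k) (flowD R 𝓘 c Qs Qbs D₀ k) (flowH R 𝓘 c Qs Qbs D₀ k)
        (flowHb R 𝓘 c Qs Qbs D₀ k) (flowS R 𝓘 c Qs Qbs D₀ k) (psiBarOf R (es k)) (psiOf R (es k))
        (fun i => ι R (vbar i)) (fun j => ι R (v j)) := by
  induction k with
  | zero =>
    rw [iterGeneratingFn, generatingFn_flow_zero]
  | succ k ih =>
    rw [iterGeneratingFn, ih fun j hj => hF j (hj.trans k.lt_succ_self)]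
    have hab : ∀ (y : 𝓘 (k + 1)) (l : 𝓘 k ⊕ₗ 𝓘 k),
        (Pi.single (es (k + 1) (toLex (Sum.inl y))) 1 : J → R) (es k l) = 0 := fun y l =>
      Pi.single_eq_of_ne (hes k _ l).symm _
    have ha : ∀ (y : 𝓘 (k + 1)) (l : 𝓘 k ⊕ₗ 𝓘 k),
        (Pi.single (es (k + 1) (toLex (Sum.inr y))) 1 : J → R) (es k l) = 0 := fun y l =>
      Pi.single_eq_of_ne (hes k _ l).symm _
    exact berezinOn_blockWeight_mul_generatingFn_flow R 𝓘 c Qs Qbs D₀ k (es k) (hF k k.lt_succ_self)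
      (fun y => Pi.single (es (k + 1) (toLex (Sum.inl y))) 1)
      (fun y => Pi.single (es (k + 1) (toLex (Sum.inr y))) 1) hab ha vbar v
      (fun i l => hvbar i k l) (fun i l => hv i k l)

end Iterated

end FermionBlockRG

end QLatticeAQFT

end Literature.MathematicalPhysics.QuantumLattice
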